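/-
Copyright: lit-balaban Phase-2 proof seat p02 (gen 12).  Statement-level skeleton of a published paper; no proof claims beyond what
the kernel checks below.
-/
import Literature.MathematicalPhysics.QuantumFieldTheory.BalabanImbrieJaffe1984to88.BIJ88W1Prime543Torus

/-!
# `BalabanImbrieJaffe1984to88.BIJ88W1Prime543Bound` — T. Bałaban, J. Imbrie, A. Jaffe, *Effective action and cluster properties of the
abelian Higgs model*, Commun. Math. Phys. **114** (1988) 257–315 [BalabanImbrieJaffe1988], §5.4 p. 282 [PDF 26]: **THE p. 282 BOUND FOR THE
TAIL KERNEL `w′₁ = (𝒟_k − 𝒟_{k,loc})∂*Q^{e*}_k∂□` ON EVERY TORUS OF THE SERIES FOR THE KERNELS OF RECORD — r16's typed shape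
`BIJ88Sect5StatementsPart2.Ineq547` INHABITED, NO HYPOTHESIS: `|w′₁(b, b′)| ≤ e^{−cρ_k}e^{−c dist_k(b₋, b′₋)}`** (`ineq547_w1P_torus`), for every
radius schedule `ρ` beyond a threshold that has the printed SCALE GAP `ρ_j ≥ ρ_k + (k−j)θ₀` ((2.2)–(2.3): `r(e_j) ≥ r(e_k) + (k−j)θ_k`, p08 g4's
`rLen_scale_gap`).  The route is the print's: per scale `j < k` the dressed tail is `O((L^jη)^{−…}e^{−cr(e_j)})` with a GROWING scale factor
(«scaling properties of these kernels»), and the scale sum is beaten by the growth of `r(e_j)` down the hierarchy («≦ Σ_{j=1}^{k−1}(L^jη)^{−…}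
e^{−cr(e_j)}e^{−c dist} ≦ e^{−cr(e_k)}e^{−c dist}»).  File 2 of the p02 programme for r16's flip condition of row C2.Eq5.4.7 (file 1 =
`BIJ88W1Prime543Torus`: the definitions and the exact reduction `w1P_eq_sum`).

statement-level skeleton of published theorems with citation tags; proofs where landed; nothing here is a claim about the Yang–Mills mass gap

PDF held: `paper:balaban1988-cmp114-bij-abelian-higgs-effective-action` (journal page = PDF page + 256).  Page read this session AS AN IMAGE:
p. 282 [PDF 26] (`HOME/lit-balaban-r16/renders/cmp114/original-p026-x2.png`).

CITATION HEADER (lean-in-tree rule).  Part of the lit-balaban TYPED SKELETON (HOME `run/shared/lean/pub/lit-balaban/`), Phase-2 proof seat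
p02 (gen 12), unit `lit-balaban-p02`; free-target protocol G.5-34(d), TAKING line HOME/STATUS.md 2026-08-22T02:38Z.  WHAT IS REPRODUCED =
SKELETON row **C2.Eq5.4.7** (owner r16, referee ref-5), the p. 282 bound for `w′₁`, kind «model instance for the kernels of record».  Decls
used BY NAME (nothing restated): file 1's `w1P`/`tT`/`w1P_eq_sum`/`abs_w1P_le_sum`/`tT_eq_face_sum`/`sum_abs_curl_boxSingle_mul_le`; p08's
(I)/(I2) per-scale lemmas `BIJ88CurlyDkLocCloseTorus.abs_hKer_sub_hlKer_le`/`abs_cKer_sub_clKer_ambient_le`/`cSide_of_cloc_estimates`,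
`BIJ88OpCloseDkLocGradTorus.abs_hKer_shift_sub_le`/`abs_grad_hKer_sub_hlKer_le`, `BIJ88CurlyDkLocDecayTorus.abs_hlKer_le_of_sup`/
`abs_clKer_ambient_le`, p08 g7's `BIJ88Decay216Torus.triple_sum_le`/`supDist_ctr_le_of_mem` and `BIJ88Ineq217Ineq722Torus.exists_bound_of_ineq722`,
r18's `cKer_ambient_eq`; p09's `cloc_estimates`/`ineq722_deltaA_of_prop12Printed`, p16's `prop12Printed_levStd_deltaA`, p13/p08's
`exists_cutoffProfile_lipschitz`, p31's `card_edgeBTo`; r16's typed `Ineq547`.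

THE PRINTED TEXT (p. 282 [PDF 26], verbatim): *"The kernel w′₁ = (𝒟_k − 𝒟_{k,loc})∂*Q^{e*}_k∂□ involves only the tails not included in the
expansion (2.12). Using the regularity and exponential decay of H_j, H_{j,loc}, along with (2.7) and scaling properties of these kernels, we find
that |(∂w′₁)(p,b′)| ≦ Σ_{j=1}^{k−1} (L^jη)^{−1−(d−2)−1+(d−2)}e^{−cr(e_j)}e^{−c dist(p,b′)} ≦ e^{−cr(e_k)}e^{−c dist(p,b′)}, and similarly for w′₁,
∂*w′₁."*

THE MECHANISM.  By file 1, `w′₁(b,b′) = Σ_{p′}(∂□e_{b′})(p′)Σ_{j<k}T_j(b,p′)` and `T_j(b,p′) = (L^k)^{−(d−2)}Σ_{p∈B^e_k(p′)}Σ_{b₁,b₂}[H_jC^{(j),L^jη}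
(∂^ηH_j(·,b₂))(p) − H_{j,loc}C^{(j),L^jη}_{loc}(∂^ηH_{j,loc}(·,b₂))(p)]`.  Per face plaquette the bracket telescopes into three products, each
with ONE small factor — `H_j − H_{j,loc} = O(e^{−(δ/2)(ρ_j/16)})` ((2.7)), `C^{(j)} − C^{(j)}_{loc} = O(e^{−(δ_C/4)ρ_j})` ((2.8)–(2.9)), and the
DRESSED (2.7) `∂^η(H_j − H_{j,loc})(·,b₂) = O(L^{k−j}e^{−(δ/2)(ρ_j/16)})` (the gradient member of (I.7.2.2) + the Lipschitz profile) — and bounded by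
the kernel-generic `abs_triple_vec_le` (double convolution `triple_sum_le`); the right factor `∂^ηH_j(·,b₂)` costs `L^{k−j}` («(L^jη)^{−1}», the
derivative of a kernel smooth on scale `L^jη`) and the ambient `C^{(j),L^jη}` costs `(L^{k−j})^{d−2}` («(L^jη)^{−(d−2)}»).  The face `B^e_k(p′)`
(`(L^k)^{d−2}` plaquettes) is summed crudely against the `(L^k)^{−(d−2)}` of `Q^e_k`, so the per-scale factor here is `(L^{k−j})^{d−1}` where the
print's finer face count («+(d−2)») gives `(L^{k−j})^{1}`; either way the scale sum `Σ_{j<k}Λ^{k−j}e^{−c₁ρ_j}` is `≤ e^{−c₁ρ_k}` as soon as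
`ρ_j − ρ_k ≥ (k−j)θ` with `Λe^{−c₁θ} ≤ ½` (`sum_pow_smallness_le`; for the printed schedule `θ_k = r|log e_k⁻¹|^{r−1}((4−d)/2)log L → ∞`).

WHAT IS PROVED (0 `sorry`, standard axioms; theorems only — proof lane; every `d ≥ 2`):
* §1 **`abs_triple_vec_le`** (kernel-generic, both outer factors VECTORS: `|Σ_{b₁b₂}Λ(b₁)C(b₁,b₂)r(b₂)| ≤ M₁M₂M_C d²e^{a/2}K(a)²e^{−a|x₁−x₂|_∞/L^j}`
  for `Λ` localized at `x₁`, `r` at `x₂`).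
* §2 the dressed right factors: **`abs_curl_hKer_col_le`** (`|∂^ηH_j(·,b₂)(p)| ≤ 2L^{k−j}Me^{−δ dist}`), **`abs_curl_hKer_sub_hlKer_col_le`**
  (the dressed (2.7)), `abs_curl_hlKer_col_le`.
* §3 **`abs_faceTerm_left_le`** — THE INTERFACE FOR THE `∂`/`∂*` MEMBERS (p08's design note 03:08Z): the scale-`j` integrand at one face plaquette
  with the LEFT FACTOR ABSTRACTED to vectors `Λ, Λ_l` localized at `x₁` (`|Λ_l| ≤ λ₀e^{−(δ/2)dist}`, `|Λ − Λ_l| ≤ λ₀e^{−(δ/2)(r/16)}e^{−(δ/2)dist}`):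
  `≤ S(r)·2λ₀MM_C(L^{k−j})^{d−1}d²e^{a/2}K(a)²e^{−a|x₁−p₋|_∞/L^j}`; the instance **`abs_faceTerm_le`** (`Λ = H_j(b,·)`, `λ₀ = M`).
* §4 `exp_face_le`, `leftPair_eq_face_sum`, **`abs_leftFace_le`** (left-abstracted face average: `≤ S(ρ_j)·2λ₀MM_C(L^{k−j})^{d−1}d²e^{a/2}K(a)²·e^{a/2}
  e^{−a dist_k(x₁,p′₋)}`) and the instance **`abs_tT_le`** (`|T_j(b,p′)| ≤ S(ρ_j)·2M²M_C(L^{k−j})^{d−1}…e^{−a dist_k(b₋,p′₋)}`).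
* §5 **`sum_pow_smallness_le`** (the resummation), **`abs_sum_tT_le`** (`|Σ_{j<k}T_j(b,p′)| ≤ const·e^{−c₁ρ_k}e^{−a dist_k(b₋,p′₋)}`,
  `c₁ = min(δ/32, δ_C/4)`).
* §6 `distEU_coarse_shift_le`, **`abs_w1P_le`** (`|w′₁(b,b′)| ≤ 4d·const·e^{a}·e^{−c₁ρ_k}e^{−a dist_k(b₋,b′₋)}`, all constants explicit).
* §7 **`ineq547_w1P_torus`** — NO HYPOTHESIS: `∃ c θ₀ ρ₁ > 0 ∀ k ≤ m + K ∀ ρ` (`ρ_k ≥ ρ₁`, scale gap `θ₀`) `∀ |χ| ≤ 1`,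
  `Ineq547 (PBond P 0) (PBond P k) (w1P hd ρ k χ) (fun b b′ ↦ dist_k(b₋,b′₋)) c (ρ k)`.
* §8 **`ineq547_w1P_allTori_of_prop12Printed`** (ONE `(c, θ₀, ρ₁)` for every torus `P.d = d`, `P.L = L` from the all-tori `B5.Prop12Printed`)
  and **`ineq547_w1P_allTori`** (the same, HYPOTHESIS-FREE via p19's `prop12Printed_allTori`).
HONEST SCOPE.  (i) `w′₁` only (the value member): `∂w′₁`, `∂*w′₁` (one more output difference, factor `(L^{k−j})²`; p08's (I2) left-gradient
machinery) and `w₁ = w′₁ + H_k□ − H_{k,loc}` (additivity with p02 g8's `ineq547_w1HkPart3_allTori`) are the sequel.  (ii) The schedule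
hypotheses are displayed: a threshold `ρ_k ≥ ρ₁` (absorbing the O(1) prefactor, «e_k small») and the scale gap with `L^{d−1}e^{−c₁θ₀} = ½`
(print: the growth of `r(e_j)`, (2.2)–(2.3)); the constants `(c, θ₀, ρ₁)` depend only on `d, L` and the
(I.7.2.2)/(2.8) constants of record (§8: one set for all tori).  (iii) Face count crude (`(L^{k−j})^{d−1}` per scale instead
of print's `(L^{k−j})^{1}`) — reading note HOME/GAPS.md G-C2-22; immaterial for the displayed bound.  (iv) `U = 1`, real abelian fields, torus,
standing range; distances `distEU`/`supDist` of the cited files; constants explicit, not optimal.  (v) No `def`, no new named fact; NOT summit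
progress.  Unit `lit-balaban-p02` (literature-prover-lit-balaban-p02-g12-0), 2026-08-22.
-/

open scoped BigOperators RealInnerProductSpace

namespace Literature.MathematicalPhysics.QuantumFieldTheory.BalabanImbrieJaffe1984to88.BIJ88W1Prime543Bound

open Balaban1983to89 hiding Site Plaq
open Balaban1983to89.LatticeFieldCalculus
open BIJ88Ineq217Ineq722Torus (ofLp_HkE_single exists_bound_of_ineq722 torusKernelData_gradH_nonneg)
open BIJ85Eq721MinimizerKernel (torusKernelData_gradH)
open BIJ85AxialPropagator411 (toE)
open BIJ85Prop521Torus BIJ85Prop522Torus BIJ85Sigma422Eta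
open BIJ85Sect7Statements BIJ85Ineq722Torus
open BIJ85Ineq722DeltaA (deltaAData ineq722_deltaA_of_prop12Printed)
open BIJ85Ineq722ProofPart2 (settingOf)
open BIJ85CellAverages
open BIJ85Eq224Base0 (torusEdgeCellsTo card_edgeBTo)
open BIJ88ClocFactorsTorus (Cmat distB distB_apply)
open BIJ88ClocEstimatesTorus (Cloc cloc_estimates)
open BIJ88Cutoffs21 (cutoff cutoffProfile cutoffProfile_eq_one cutoff_nonneg cutoff_le_one)
open BIJ88Sect2Statements (applyK)
open BIJ88Sect5StatementsPart2 (Ineq547)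
open BIJ85Prop12PerTower (prop12Printed_levStd_deltaA)
open BIJ85Prop12AllTori (prop12Printed_allTori)
open BIJ88Decay223CkAllTori (exists_HB_allTori_of_prop12Printed)
open BIJ88Decay216Torus (triple_sum_le supDist_ctr_le_of_mem iterBlockOf_eq_of_mem_edgeB distEU_sub_le)
open BIJ88CurlyDkLocTorus BIJ88CurlyDkLocDecayTorus BIJ88OpCloseDkLocTorus
open BIJ88CurlyDkLocGradTerm (abs_distEU_shift_sub_le exists_cutoffProfile_lipschitz)
open BIJ88OpCloseDkLocGradTorus (abs_hKer_shift_sub_le abs_grad_hKer_sub_hlKer_le)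
open BIJ88CurlyDkLocCloseTorus (abs_hKer_sub_hlKer_le abs_cKer_sub_clKer_ambient_le cSide_of_cloc_estimates)
open BIJ88W1Prime543Torus
-- inside this namespace the bare `Site`/`Plaq` are the `ℤ^d` carriers of the QFT root; the torus ones are renamed:
open Balaban1983to89 renaming Site → TSite, Plaq → TPlaq

noncomputable section

variable {P : Params}

/-- `0 < L^n`. [folklore] -/
private theorem cast_pow_L_pos' (n : ℕ) : (0 : ℝ) < (P.L : ℝ) ^ n := pow_pos P.cast_L_pos n

/-- `L^k = L^j·L^{k−j}` for `j ≤ k`. [folklore] -/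
private theorem pow_eq_pow_mul_pow' {j k : ℕ} (hjk : j ≤ k) : (P.L : ℝ) ^ k = (P.L : ℝ) ^ j * (P.L : ℝ) ^ (k - j) := by
  rw [← pow_add, Nat.add_sub_cancel' hjk]

/-- `Σ_b f(b₋) = d·Σ_y f(y)` on `T^{(j)}`. [folklore] -/
private theorem sum_bond_src {j : ℕ} (f : TSite P j → ℝ) : ∑ b : PBond P j, f b.src = (P.d : ℝ) * ∑ y : TSite P j, f y := by
  rw [← Fintype.sum_equiv (LatticeFieldCalculus.bondEquiv (P := P) (j := j)) (fun q : TSite P j × Fin P.d => f q.1) _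
    (fun q => rfl), Fintype.sum_prod_type]
  simp only [Finset.sum_const, Finset.card_univ, Fintype.card_fin, nsmul_eq_mul]
  rw [Finset.mul_sum]

/-! ## §1  A kernel-generic pointwise triple bound with a vector right factor -/

/-- **THE PER-SCALE POINTWISE ESTIMATE WITH DRESSED FACTORS ON BOTH SIDES** (`j ≤ m + K`): for VECTORS `Λ(b₁)` localized at a fine site `x₁`
(`|Λ(b₁)| ≤ M₁e^{−δ dist(x₁,b₁)}`, the (7.2.2) distance `distEU P j`), `r(b₂)` localized at `x₂` (`|r(b₂)| ≤ M₂e^{−δ dist(x₂,b₂)}`) and a kernel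
`C(b₁, b₂)` (`|C| ≤ M_Ce^{−δ_C|b₁₋−b₂₋|_∞}`), `|Σ_{b₁,b₂} Λ(b₁)C(b₁,b₂)r(b₂)| ≤ M₁M₂M_C·d²e^{a/2}K(a)²·e^{−a|x₁−x₂|_∞/L^j}`, `a = min(δ,δ_C)/2` —
p08's `abs_triple_le` with both outer kernels replaced by vectors (left: a row `H_j(b,·)` or one of its output differences; right: the face
plaquette's `(∂^ηH_j(·,b₂))(p)`), same double convolution `triple_sum_le`.  This is the interface for the `∂`/`∂*` members (p08).
[cite: BalabanImbrieJaffe1988, (2.12) p.261] -/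
theorem abs_triple_vec_le {j : ℕ} (hj : j ≤ P.m + P.K) {δ M₁ M₂ δC MC : ℝ} (hδ : 0 < δ) (hδC : 0 < δC) (hM₁ : 0 ≤ M₁) (hM₂ : 0 ≤ M₂)
    (hMC : 0 ≤ MC) {Λ : PBond P j → ℝ} {C : PBond P j → PBond P j → ℝ} {r : PBond P j → ℝ} {x₁ x₂ : TSite P 0}
    (hΛ : ∀ b₁ : PBond P j, |Λ b₁| ≤ M₁ * Real.exp (-(δ * distEU P j x₁ b₁.src)))
    (hC : ∀ b₁ b₂ : PBond P j, |C b₁ b₂| ≤ MC * Real.exp (-(δC * (supDist b₁.src b₂.src : ℝ))))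
    (hr : ∀ b₂ : PBond P j, |r b₂| ≤ M₂ * Real.exp (-(δ * distEU P j x₂ b₂.src))) :
    |∑ b₁ : PBond P j, ∑ b₂ : PBond P j, Λ b₁ * C b₁ b₂ * r b₂| ≤
      M₁ * M₂ * MC * (P.d : ℝ) ^ 2 * (Real.exp (min δ δC / 2 / 2) * ((2 * (1 + P.d / (min δ δC / 2))) ^ P.d) ^ 2) *
        Real.exp (-(min δ δC / 2 * ((supDist x₁ x₂ : ℝ) / (P.L : ℝ) ^ j))) := by
  have hpt : ∀ b₁ b₂ : PBond P j, |Λ b₁ * C b₁ b₂ * r b₂| ≤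
      M₁ * M₂ * MC * (Real.exp (-(δ * distEU P j x₁ b₁.src)) * Real.exp (-(δC * (supDist b₁.src b₂.src : ℝ))) *
        Real.exp (-(δ * distEU P j x₂ b₂.src))) := by
    intro b₁ b₂
    rw [abs_mul, abs_mul]
    have h1 := hΛ b₁
    have h2 := hr b₂
    have h3 := hC b₁ b₂
    calc _ ≤ (M₁ * Real.exp (-(δ * distEU P j x₁ b₁.src))) * (MC * Real.exp (-(δC * (supDist b₁.src b₂.src : ℝ)))) *
          (M₂ * Real.exp (-(δ * distEU P j x₂ b₂.src))) :=
          mul_le_mul (mul_le_mul h1 h3 (abs_nonneg _) (by positivity)) h2 (abs_nonneg _) (by positivity)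
      _ = _ := by ring
  calc _ ≤ ∑ b₁ : PBond P j, ∑ b₂ : PBond P j, M₁ * M₂ * MC * (Real.exp (-(δ * distEU P j x₁ b₁.src)) *
          Real.exp (-(δC * (supDist b₁.src b₂.src : ℝ))) * Real.exp (-(δ * distEU P j x₂ b₂.src))) :=
        (Finset.abs_sum_le_sum_abs _ _).trans (Finset.sum_le_sum fun b₁ _ =>
          (Finset.abs_sum_le_sum_abs _ _).trans (Finset.sum_le_sum fun b₂ _ => hpt b₁ b₂))
    _ = M₁ * M₂ * MC * ((P.d : ℝ) * ∑ y : TSite P j, (P.d : ℝ) * ∑ y' : TSite P j, Real.exp (-(δ * distEU P j x₁ y)) *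
          Real.exp (-(δC * (supDist y y' : ℝ))) * Real.exp (-(δ * distEU P j x₂ y'))) := by
        rw [← sum_bond_src (fun y => (P.d : ℝ) * ∑ y' : TSite P j, Real.exp (-(δ * distEU P j x₁ y)) *
          Real.exp (-(δC * (supDist y y' : ℝ))) * Real.exp (-(δ * distEU P j x₂ y'))), Finset.mul_sum]
        refine Finset.sum_congr rfl fun b₁ _ => ?_
        rw [← sum_bond_src (fun y' => Real.exp (-(δ * distEU P j x₁ b₁.src)) * Real.exp (-(δC * (supDist b₁.src y' : ℝ))) *
          Real.exp (-(δ * distEU P j x₂ y'))), Finset.mul_sum]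
    _ = M₁ * M₂ * MC * (P.d : ℝ) ^ 2 * ∑ y : TSite P j, ∑ y' : TSite P j, Real.exp (-(δ * distEU P j x₁ y)) *
          Real.exp (-(δC * (supDist y y' : ℝ))) * Real.exp (-(δ * distEU P j x₂ y')) := by
        rw [← Finset.mul_sum]; ring
    _ ≤ M₁ * M₂ * MC * (P.d : ℝ) ^ 2 * (Real.exp (min δ δC / 2 / 2) * ((2 * (1 + P.d / (min δ δC / 2))) ^ P.d) ^ 2 *
          Real.exp (-(min δ δC / 2 * ((supDist x₁ x₂ : ℝ) / (P.L : ℝ) ^ j)))) :=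
        mul_le_mul_of_nonneg_left (triple_sum_le hj hδ hδC x₁ x₂) (by positivity)
    _ = _ := by ring

/-! ## §2  The dressed right factors: `(∂^ηH_j(·,b₂))(p)`, `(∂^ηH_{j,loc}(·,b₂))(p)` and their difference -/

/-- the `η`-curl of a column at a fine plaquette as two shift differences:
`(∂^ηA)(p) = L^k[(A(x+e_μ,ν) − A(x,ν)) − (A(x+e_ν,μ) − A(x,μ))]`. [cite: Balaban1984PropagatorsI, (1.2) p.18] -/
private theorem curl_eq_two_diffs {c : ℝ} (A : PBond P 0 → ℝ) (p : TPlaq P 0) :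
    curl c A p = c * ((A ⟨p.src.shift p.μ, p.ν⟩ - A ⟨p.src, p.ν⟩) - (A ⟨p.src.shift p.ν, p.μ⟩ - A ⟨p.src, p.μ⟩)) := by
  simp only [curl, smul_eq_mul]; ring

/-- **`|(∂^ηH_j(·, b₂))(p)| ≤ 2L^{k−j}Me^{−δ dist(p₋, b₂)}`** from the gradient member of (I.7.2.2) (p08's `abs_hKer_shift_sub_le`, twice) and
`∂^η = L^k·(differences)`, `L^k·L^{−j} = L^{k−j}` (`j ≤ k`) — print's «(L^jη)^{−1}» for the derivative. [cite: BalabanImbrieJaffe1988, (5.4.3) p.282] -/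
theorem abs_curl_hKer_col_le {j k : ℕ} (hj : j ≤ P.m + P.K) (hjk : j ≤ k) {w c : ℝ} (hw : 0 < w) (hc : c ≠ 0) {a : ℝ} (ha : 0 < a)
    {δ M : ℝ}
    (hB : ∀ (μ ν : Fin P.d) (x : TSite P 0) (y : TSite P j),
      ‖fun lam : Fin P.d => (P.L : ℝ) ^ j *
          ((torusRep P j (deltaAData hj a)).H (x.shift lam, μ) (y, ν) - (torusRep P j (deltaAData hj a)).H (x, μ) (y, ν))‖ ≤
        M * Real.exp (-(δ * distEU P j x y)))
    (b₂ : PBond P j) (p : TPlaq P 0) :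
    |curl ((P.L : ℝ) ^ k) (fun b'' : PBond P 0 => hKer (P := P) w c j b'' b₂) p| ≤
      2 * (P.L : ℝ) ^ (k - j) * M * Real.exp (-(δ * distEU P j p.src b₂.src)) := by
  have hLk : 0 < (P.L : ℝ) ^ k := cast_pow_L_pos' k
  have hLj : 0 < (P.L : ℝ) ^ j := cast_pow_L_pos' j
  have h1 := abs_hKer_shift_sub_le hj hw hc ha hB p.src p.ν p.μ b₂
  have h2 := abs_hKer_shift_sub_le hj hw hc ha hB p.src p.μ p.ν b₂
  rw [curl_eq_two_diffs, abs_mul, abs_of_pos hLk]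
  have h3 := abs_sub (hKer (P := P) w c j ⟨p.src.shift p.μ, p.ν⟩ b₂ - hKer (P := P) w c j ⟨p.src, p.ν⟩ b₂)
    (hKer (P := P) w c j ⟨p.src.shift p.ν, p.μ⟩ b₂ - hKer (P := P) w c j ⟨p.src, p.μ⟩ b₂)
  have hsc : (P.L : ℝ) ^ k * ((P.L : ℝ) ^ j)⁻¹ = (P.L : ℝ) ^ (k - j) := by
    rw [pow_eq_pow_mul_pow' hjk, mul_comm, ← mul_assoc, inv_mul_cancel₀ hLj.ne', one_mul]
  calc (P.L : ℝ) ^ k * |(hKer (P := P) w c j ⟨p.src.shift p.μ, p.ν⟩ b₂ - hKer (P := P) w c j ⟨p.src, p.ν⟩ b₂) -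
          (hKer (P := P) w c j ⟨p.src.shift p.ν, p.μ⟩ b₂ - hKer (P := P) w c j ⟨p.src, p.μ⟩ b₂)|
      ≤ (P.L : ℝ) ^ k * (((P.L : ℝ) ^ j)⁻¹ * M * Real.exp (-(δ * distEU P j p.src b₂.src)) +
          ((P.L : ℝ) ^ j)⁻¹ * M * Real.exp (-(δ * distEU P j p.src b₂.src))) :=
        mul_le_mul_of_nonneg_left (h3.trans (add_le_add h1 h2)) hLk.le
    _ = 2 * ((P.L : ℝ) ^ k * ((P.L : ℝ) ^ j)⁻¹) * M * Real.exp (-(δ * distEU P j p.src b₂.src)) := by ring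
    _ = _ := by rw [hsc]

/-- **`|(∂^η(H_j − H_{j,loc})(·, b₂))(p)| ≤ 2L^{k−j}M(1 + C_σ/(R₀−R₁))e^{δ/2}e^{−(δ/2)R₁}·e^{−(δ/2)dist(p₋,b₂)}`** — the dressed (2.7): p08's
`abs_grad_hKer_sub_hlKer_le` twice. [cite: BalabanImbrieJaffe1988, (2.7) p.260] -/
theorem abs_curl_hKer_sub_hlKer_col_le {j k : ℕ} (hj : j ≤ P.m + P.K) (hjk : j ≤ k) {w c : ℝ} (hw : 0 < w) (hc : c ≠ 0) {a : ℝ}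
    (ha : 0 < a) {δ M : ℝ} (hδ : 0 ≤ δ)
    (hH : ∀ (μ ν : Fin P.d) (x : TSite P 0) (y : TSite P j),
      |(torusRep P j (deltaAData hj a)).H (x, μ) (y, ν)| ≤ M * Real.exp (-(δ * distEU P j x y)))
    (hB : ∀ (μ ν : Fin P.d) (x : TSite P 0) (y : TSite P j),
      ‖fun lam : Fin P.d => (P.L : ℝ) ^ j *
          ((torusRep P j (deltaAData hj a)).H (x.shift lam, μ) (y, ν) - (torusRep P j (deltaAData hj a)).H (x, μ) (y, ν))‖ ≤
        M * Real.exp (-(δ * distEU P j x y)))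
    {C R₁ R₀ : ℝ} (hC0 : 0 ≤ C) (hR : R₁ < R₀)
    (hCζ : ∀ t s : ℝ, |cutoffProfile R₁ R₀ t - cutoffProfile R₁ R₀ s| ≤ C / (R₀ - R₁) * |t - s|)
    (b₂ : PBond P j) (p : TPlaq P 0) :
    |curl ((P.L : ℝ) ^ k) (fun b'' : PBond P 0 => hKer (P := P) w c j b'' b₂ - hlKer (P := P) w c R₁ R₀ j b'' b₂) p| ≤
      2 * (P.L : ℝ) ^ (k - j) * (M * (1 + C / (R₀ - R₁)) * Real.exp (δ / 2) * Real.exp (-(δ / 2 * R₁))) *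
        Real.exp (-(δ / 2 * distEU P j p.src b₂.src)) := by
  have hLk : 0 < (P.L : ℝ) ^ k := cast_pow_L_pos' k
  have hLj : 0 < (P.L : ℝ) ^ j := cast_pow_L_pos' j
  have h1 := abs_grad_hKer_sub_hlKer_le hj hw hc ha hδ hH hB hC0 hR hCζ p.src p.ν p.μ b₂
  have h2 := abs_grad_hKer_sub_hlKer_le hj hw hc ha hδ hH hB hC0 hR hCζ p.src p.μ p.ν b₂
  rw [curl_eq_two_diffs, abs_mul, abs_of_pos hLk]
  have h3 := abs_sub
    ((hKer (P := P) w c j ⟨p.src.shift p.μ, p.ν⟩ b₂ - hlKer (P := P) w c R₁ R₀ j ⟨p.src.shift p.μ, p.ν⟩ b₂) -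
      (hKer (P := P) w c j ⟨p.src, p.ν⟩ b₂ - hlKer (P := P) w c R₁ R₀ j ⟨p.src, p.ν⟩ b₂))
    ((hKer (P := P) w c j ⟨p.src.shift p.ν, p.μ⟩ b₂ - hlKer (P := P) w c R₁ R₀ j ⟨p.src.shift p.ν, p.μ⟩ b₂) -
      (hKer (P := P) w c j ⟨p.src, p.μ⟩ b₂ - hlKer (P := P) w c R₁ R₀ j ⟨p.src, p.μ⟩ b₂))
  have hsc : (P.L : ℝ) ^ k * ((P.L : ℝ) ^ j)⁻¹ = (P.L : ℝ) ^ (k - j) := by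
    rw [pow_eq_pow_mul_pow' hjk, mul_comm, ← mul_assoc, inv_mul_cancel₀ hLj.ne', one_mul]
  set X : ℝ := M * (1 + C / (R₀ - R₁)) * Real.exp (δ / 2) * Real.exp (-(δ / 2 * R₁))
  calc (P.L : ℝ) ^ k * |((hKer (P := P) w c j ⟨p.src.shift p.μ, p.ν⟩ b₂ - hlKer (P := P) w c R₁ R₀ j ⟨p.src.shift p.μ, p.ν⟩ b₂) -
          (hKer (P := P) w c j ⟨p.src, p.ν⟩ b₂ - hlKer (P := P) w c R₁ R₀ j ⟨p.src, p.ν⟩ b₂)) -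
        ((hKer (P := P) w c j ⟨p.src.shift p.ν, p.μ⟩ b₂ - hlKer (P := P) w c R₁ R₀ j ⟨p.src.shift p.ν, p.μ⟩ b₂) -
          (hKer (P := P) w c j ⟨p.src, p.μ⟩ b₂ - hlKer (P := P) w c R₁ R₀ j ⟨p.src, p.μ⟩ b₂))|
      ≤ (P.L : ℝ) ^ k * ((((P.L : ℝ) ^ j)⁻¹ * X) * Real.exp (-(δ / 2 * distEU P j p.src b₂.src)) +
          (((P.L : ℝ) ^ j)⁻¹ * X) * Real.exp (-(δ / 2 * distEU P j p.src b₂.src))) :=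
        mul_le_mul_of_nonneg_left (h3.trans (add_le_add h1 h2)) hLk.le
    _ = 2 * ((P.L : ℝ) ^ k * ((P.L : ℝ) ^ j)⁻¹) * X * Real.exp (-(δ / 2 * distEU P j p.src b₂.src)) := by ring
    _ = _ := by rw [hsc]

/-- **`|(∂^ηH_{j,loc}(·, b₂))(p)| ≤ 2L^{k−j}M(1 + (1 + C_σ/(R₀−R₁))e^{δ/2})·e^{−(δ/2)dist(p₋,b₂)}`** (`H_{j,loc} = H_j − (H_j − H_{j,loc})`,
the two lemmas above). [cite: BalabanImbrieJaffe1988, (2.5) p.260] -/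
theorem abs_curl_hlKer_col_le {j k : ℕ} (hj : j ≤ P.m + P.K) (hjk : j ≤ k) {w c : ℝ} (hw : 0 < w) (hc : c ≠ 0) {a : ℝ}
    (ha : 0 < a) {δ M : ℝ} (hδ : 0 ≤ δ)
    (hH : ∀ (μ ν : Fin P.d) (x : TSite P 0) (y : TSite P j),
      |(torusRep P j (deltaAData hj a)).H (x, μ) (y, ν)| ≤ M * Real.exp (-(δ * distEU P j x y)))
    (hB : ∀ (μ ν : Fin P.d) (x : TSite P 0) (y : TSite P j),
      ‖fun lam : Fin P.d => (P.L : ℝ) ^ j *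
          ((torusRep P j (deltaAData hj a)).H (x.shift lam, μ) (y, ν) - (torusRep P j (deltaAData hj a)).H (x, μ) (y, ν))‖ ≤
        M * Real.exp (-(δ * distEU P j x y)))
    {C R₁ R₀ : ℝ} (hC0 : 0 ≤ C) (hR : R₁ < R₀) (hR₁ : 0 ≤ R₁)
    (hCζ : ∀ t s : ℝ, |cutoffProfile R₁ R₀ t - cutoffProfile R₁ R₀ s| ≤ C / (R₀ - R₁) * |t - s|)
    (b₂ : PBond P j) (p : TPlaq P 0) :
    |curl ((P.L : ℝ) ^ k) (fun b'' : PBond P 0 => hlKer (P := P) w c R₁ R₀ j b'' b₂) p| ≤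
      2 * (P.L : ℝ) ^ (k - j) * (M * (1 + (1 + C / (R₀ - R₁)) * Real.exp (δ / 2))) *
        Real.exp (-(δ / 2 * distEU P j p.src b₂.src)) := by
  have hM : 0 ≤ M := by
    have h := hH ⟨0, P.hd⟩ ⟨0, P.hd⟩ default default
    exact (mul_nonneg_iff_of_pos_right (Real.exp_pos _)).1 ((abs_nonneg _).trans h)
  have hsplit : curl ((P.L : ℝ) ^ k) (fun b'' : PBond P 0 => hlKer (P := P) w c R₁ R₀ j b'' b₂) p =
      curl ((P.L : ℝ) ^ k) (fun b'' : PBond P 0 => hKer (P := P) w c j b'' b₂) p -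
        curl ((P.L : ℝ) ^ k) (fun b'' : PBond P 0 => hKer (P := P) w c j b'' b₂ - hlKer (P := P) w c R₁ R₀ j b'' b₂) p := by
    rw [← curl_sub]
    congr 1
    funext b''
    ring
  have h1 := abs_curl_hKer_col_le (k := k) hj hjk hw hc ha hB b₂ p
  have h2 := abs_curl_hKer_sub_hlKer_col_le (k := k) hj hjk hw hc ha hδ hH hB hC0 hR hCζ b₂ p
  have hD : 0 ≤ distEU P j p.src b₂.src := div_nonneg (Nat.cast_nonneg _) (cast_pow_L_pos' j).le
  have hweak : Real.exp (-(δ * distEU P j p.src b₂.src)) ≤ Real.exp (-(δ / 2 * distEU P j p.src b₂.src)) :=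
    Real.exp_le_exp.2 (by nlinarith)
  have hR1 : Real.exp (-(δ / 2 * R₁)) ≤ 1 := by
    rw [Real.exp_le_one_iff]; nlinarith
  have hℓ : 0 ≤ (P.L : ℝ) ^ (k - j) := (cast_pow_L_pos' _).le
  have hw0 : 0 < R₀ - R₁ := sub_pos.2 hR
  rw [hsplit]
  refine (abs_sub _ _).trans ?_
  have e1 : |curl ((P.L : ℝ) ^ k) (fun b'' : PBond P 0 => hKer (P := P) w c j b'' b₂) p| ≤
      2 * (P.L : ℝ) ^ (k - j) * M * Real.exp (-(δ / 2 * distEU P j p.src b₂.src)) :=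
    h1.trans (mul_le_mul_of_nonneg_left hweak (by positivity))
  have e2 : |curl ((P.L : ℝ) ^ k) (fun b'' : PBond P 0 => hKer (P := P) w c j b'' b₂ - hlKer (P := P) w c R₁ R₀ j b'' b₂) p| ≤
      2 * (P.L : ℝ) ^ (k - j) * (M * (1 + C / (R₀ - R₁)) * Real.exp (δ / 2) * 1) *
        Real.exp (-(δ / 2 * distEU P j p.src b₂.src)) := by
    refine h2.trans (mul_le_mul_of_nonneg_right (mul_le_mul_of_nonneg_left ?_ (by positivity)) (Real.exp_pos _).le)
    exact mul_le_mul_of_nonneg_left hR1 (by positivity)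
  calc _ ≤ 2 * (P.L : ℝ) ^ (k - j) * M * Real.exp (-(δ / 2 * distEU P j p.src b₂.src)) +
        2 * (P.L : ℝ) ^ (k - j) * (M * (1 + C / (R₀ - R₁)) * Real.exp (δ / 2) * 1) *
          Real.exp (-(δ / 2 * distEU P j p.src b₂.src)) := add_le_add e1 e2
    _ = _ := by ring


/-! ## §3  The scale-`j` integrand at one face plaquette -/

/-- the telescoping `hcr − h_lc_lr_l = (h − h_l)cr + h_l(c − c_l)r + h_lc_l(r − r_l)`. [folklore] -/
private theorem telescope (h hl c cl r rl : ℝ) :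
    h * c * r - hl * cl * rl = (h - hl) * c * r + hl * (c - cl) * r + hl * cl * (r - rl) := by ring

/-- `ℓ^{d−2}·ℓ = ℓ^{d−1}` for `d ≥ 2`. [folklore] -/
private theorem pow_dm2_mul (hd : 2 ≤ P.d) (ℓ : ℝ) : ℓ ^ (P.d - 2) * ℓ = ℓ ^ (P.d - 1) := by
  rw [← pow_succ]; congr 1; omega

/-- **THE SCALE-`j` INTEGRAND AT ONE FACE PLAQUETTE, LEFT FACTOR ABSTRACTED** (`j ≤ k`, `j ≤ m + K`, `d ≥ 2`, radius `r ≥ ρ₀ > 0`; the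
interface for the `∂`/`∂*` members, p08's design note 2026-08-22T03:08Z): for VECTORS `Λ, Λ_l` on `T^{(j)}`-bonds localized at a fine site `x₁` with
`|Λ_l(b₁)| ≤ λ₀e^{−(δ/2)dist(x₁,b₁)}` and `|Λ(b₁) − Λ_l(b₁)| ≤ λ₀e^{−(δ/2)(r/16)}e^{−(δ/2)dist(x₁,b₁)}` (the row `H_j(b,·)`, `H_{j,loc}(b,·)` of `T_j`;
or an output difference of it), the sup and gradient members of (I.7.2.2) for `H_j` (`M, δ`), p09's bounds for `C^{(j)}`, `C^{(j)}_{loc}` (radius `r/4`)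
and their difference (`M_C, δ_C`), and a slope constant `C_σ` of the (2.1) profile:
`|Σ_{b₁,b₂}[Λ(b₁)C^{(j),L^jη}(b₁,b₂)(∂^ηH_j(·,b₂))(p) − Λ_l(b₁)C^{(j),L^jη}_{loc}(b₁,b₂)(∂^ηH_{j,loc}(·,b₂))(p)]| ≤
S(r)·2λ₀MM_C·(L^{k−j})^{d−1}·d²e^{a/2}K(a)²·e^{−a|x₁−p₋|_∞/L^j}`, `S(r) = e^{−(δ/2)(r/16)} + e^{−(δ_C/4)r} + (1 + 16C_σ/ρ₀)e^{δ/2}e^{−(δ/2)(r/16)}`,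
`a = min(δ/2,δ_C)/2` — the three telescoped products, each by `abs_triple_vec_le`; `(L^{k−j})^{d−1}` = print's «scaling properties»
`(L^jη)^{−(d−2)}·(L^jη)^{−1}` (the C-rescaling and the one derivative). [cite: BalabanImbrieJaffe1988, (5.4.3) p.282] -/
theorem abs_faceTerm_left_le (hd : 2 ≤ P.d) {k j : ℕ} (hj : j ≤ P.m + P.K) (hjk : j ≤ k) {a : ℝ} (ha : 0 < a)
    {δ M δC MC : ℝ} (hδ : 0 < δ) (hδC : 0 < δC) (hM : 0 ≤ M) (hMC : 0 ≤ MC)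
    (hH : ∀ (μ ν : Fin P.d) (x : TSite P 0) (y : TSite P j),
      |(torusRep P j (deltaAData hj a)).H (x, μ) (y, ν)| ≤ M * Real.exp (-(δ * distEU P j x y)))
    (hB : ∀ (μ ν : Fin P.d) (x : TSite P 0) (y : TSite P j),
      ‖fun lam : Fin P.d => (P.L : ℝ) ^ j *
          ((torusRep P j (deltaAData hj a)).H (x.shift lam, μ) (y, ν) - (torusRep P j (deltaAData hj a)).H (x, μ) (y, ν))‖ ≤
        M * Real.exp (-(δ * distEU P j x y)))
    {C : ℝ} (hC0 : 0 ≤ C) (hCζ : ∀ (R₁ R₀ : ℝ), R₁ < R₀ → ∀ t s : ℝ,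
      |cutoffProfile R₁ R₀ t - cutoffProfile R₁ R₀ s| ≤ C / (R₀ - R₁) * |t - s|)
    {r ρ₀ : ℝ} (hρ₀ : 0 < ρ₀) (hr : ρ₀ ≤ r)
    (hCm : ∀ b₁ b₂ : PBond P j, |Cmat P j b₁ b₂| ≤ MC * Real.exp (-(δC * (supDist b₁.src b₂.src : ℝ))))
    (hCl : ∀ b₁ b₂ : PBond P j, |Cloc P j (r / 4) b₁ b₂| ≤ MC * Real.exp (-(δC * (supDist b₁.src b₂.src : ℝ))))
    (hCd : ∀ b₁ b₂ : PBond P j, |Cloc P j (r / 4) b₁ b₂ - Cmat P j b₁ b₂| ≤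
      MC * Real.exp (-(δC / 4 * r)) * Real.exp (-(δC * (supDist b₁.src b₂.src : ℝ))))
    {Λ Λl : PBond P j → ℝ} {x₁ : TSite P 0} {lam0 : ℝ} (hlam0 : 0 ≤ lam0)
    (hΛl : ∀ b₁ : PBond P j, |Λl b₁| ≤ lam0 * Real.exp (-(δ / 2 * distEU P j x₁ b₁.src)))
    (hΛd : ∀ b₁ : PBond P j, |Λ b₁ - Λl b₁| ≤ lam0 * Real.exp (-(δ / 2 * (r / 16))) * Real.exp (-(δ / 2 * distEU P j x₁ b₁.src)))
    (p : TPlaq P 0) :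
    |∑ b₁ : PBond P j, ∑ b₂ : PBond P j,
        (Λ b₁ * cKer (P := P) ((P.eta k) ^ P.d) ((P.L : ℝ) ^ k) j b₁ b₂ *
            curl ((P.L : ℝ) ^ k) (fun b'' : PBond P 0 => hKer (P := P) ((P.eta k) ^ P.d) ((P.L : ℝ) ^ k) j b'' b₂) p -
          Λl b₁ * clKer (P := P) ((P.eta k) ^ P.d) ((P.L : ℝ) ^ k) (r / 4) j b₁ b₂ *
            curl ((P.L : ℝ) ^ k)
              (fun b'' : PBond P 0 => hlKer (P := P) ((P.eta k) ^ P.d) ((P.L : ℝ) ^ k) (r / 16) (r / 8) j b'' b₂) p)| ≤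
      (Real.exp (-(δ / 2 * (r / 16))) + Real.exp (-(δC / 4 * r)) + (1 + 16 * C / ρ₀) * Real.exp (δ / 2) * Real.exp (-(δ / 2 * (r / 16)))) *
        (2 * lam0 * M * MC * ((P.L : ℝ) ^ (k - j)) ^ (P.d - 1) * ((P.d : ℝ) ^ 2 *
          (Real.exp (min (δ / 2) δC / 2 / 2) * ((2 * (1 + P.d / (min (δ / 2) δC / 2))) ^ P.d) ^ 2))) *
        Real.exp (-(min (δ / 2) δC / 2 * ((supDist x₁ p.src : ℝ) / (P.L : ℝ) ^ j))) := by
  have hδ2 : 0 < δ / 2 := half_pos hδ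
  have hR : r / 16 < r / 8 := by linarith
  have hr0 : 0 < r := lt_of_lt_of_le hρ₀ hr
  have hw : 0 < (P.eta k) ^ P.d := pow_pos (eta_pos P k) _
  have hc : (P.L : ℝ) ^ k ≠ 0 := (cast_pow_L_pos' k).ne'
  set ℓ : ℝ := (P.L : ℝ) ^ (k - j) with hℓ
  have hℓ0 : 0 < ℓ := cast_pow_L_pos' _
  have hℓq : 0 < ℓ ^ (P.d - 2) := pow_pos hℓ0 _
  have hCζ' := hCζ (r / 16) (r / 8) hR
  have hRw : r / 8 - r / 16 = r / 16 := by ring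
  -- the H-side weakening to rate `δ/2`
  have weaken : ∀ (x : TSite P 0) (y : TSite P j),
      M * Real.exp (-(δ * distEU P j x y)) ≤ M * Real.exp (-(δ / 2 * distEU P j x y)) := by
    intro x y
    refine mul_le_mul_of_nonneg_left (Real.exp_le_exp.2 ?_) hM
    have h0 : 0 ≤ distEU P j x y := div_nonneg (Nat.cast_nonneg _) (cast_pow_L_pos' j).le
    nlinarith
  -- the dressed right factors at rate `δ/2`
  have hr1 : ∀ b₂ : PBond P j, |curl ((P.L : ℝ) ^ k) (fun b'' : PBond P 0 => hKer (P := P) ((P.eta k) ^ P.d) ((P.L : ℝ) ^ k) j b'' b₂) p| ≤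
      2 * ℓ * M * Real.exp (-(δ / 2 * distEU P j p.src b₂.src)) := by
    intro b₂
    refine (abs_curl_hKer_col_le (k := k) hj hjk hw hc ha hB b₂ p).trans ?_
    have := weaken p.src b₂.src
    nlinarith [hℓ0.le]
  have hr3 : ∀ b₂ : PBond P j, |(fun b₂ : PBond P j =>
      curl ((P.L : ℝ) ^ k) (fun b'' : PBond P 0 => hKer (P := P) ((P.eta k) ^ P.d) ((P.L : ℝ) ^ k) j b'' b₂) p -
        curl ((P.L : ℝ) ^ k) (fun b'' : PBond P 0 => hlKer (P := P) ((P.eta k) ^ P.d) ((P.L : ℝ) ^ k) (r / 16) (r / 8) j b'' b₂) p) b₂| ≤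
      2 * ℓ * (M * (1 + 16 * C / ρ₀) * Real.exp (δ / 2) * Real.exp (-(δ / 2 * (r / 16)))) *
        Real.exp (-(δ / 2 * distEU P j p.src b₂.src)) := by
    intro b₂
    have h := abs_curl_hKer_sub_hlKer_col_le (k := k) hj hjk hw hc ha hδ.le hH hB hC0 hR hCζ' b₂ p
    rw [curl_sub] at h
    refine h.trans ?_
    rw [hRw]
    have hfrac : C / (r / 16) ≤ 16 * C / ρ₀ := by
      rw [div_le_div_iff₀ (by positivity) hρ₀]
      nlinarith
    have hE := (Real.exp_pos (-(δ / 2 * distEU P j p.src b₂.src))).le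
    have hX : M * (1 + C / (r / 16)) * Real.exp (δ / 2) * Real.exp (-(δ / 2 * (r / 16))) ≤
        M * (1 + 16 * C / ρ₀) * Real.exp (δ / 2) * Real.exp (-(δ / 2 * (r / 16))) := by
      have : M * (1 + C / (r / 16)) ≤ M * (1 + 16 * C / ρ₀) := mul_le_mul_of_nonneg_left (by linarith) hM
      exact mul_le_mul_of_nonneg_right (mul_le_mul_of_nonneg_right this (Real.exp_pos _).le) (Real.exp_pos _).le
    exact mul_le_mul_of_nonneg_right (mul_le_mul_of_nonneg_left hX (by positivity)) hE
  -- the C-side bounds at the ambient weights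
  have hc1 : ∀ b₁ b₂ : PBond P j, |cKer (P := P) ((P.eta k) ^ P.d) ((P.L : ℝ) ^ k) j b₁ b₂| ≤
      MC * ℓ ^ (P.d - 2) * Real.exp (-(δC * (supDist b₁.src b₂.src : ℝ))) := by
    intro b₁ b₂
    rw [cKer_ambient_eq hd hjk, abs_mul, abs_of_pos hℓq]
    calc ℓ ^ (P.d - 2) * |Cmat P j b₁ b₂| ≤ ℓ ^ (P.d - 2) * (MC * Real.exp (-(δC * (supDist b₁.src b₂.src : ℝ)))) :=
        mul_le_mul_of_nonneg_left (hCm b₁ b₂) hℓq.le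
      _ = _ := by ring
  have hc2 : ∀ b₁ b₂ : PBond P j, |clKer (P := P) ((P.eta k) ^ P.d) ((P.L : ℝ) ^ k) (r / 4) j b₁ b₂| ≤
      MC * ℓ ^ (P.d - 2) * Real.exp (-(δC * (supDist b₁.src b₂.src : ℝ))) := fun b₁ b₂ => abs_clKer_ambient_le hd hjk hCl b₁ b₂
  have hc3 : ∀ b₁ b₂ : PBond P j,
      |(fun b₁ b₂ : PBond P j => cKer (P := P) ((P.eta k) ^ P.d) ((P.L : ℝ) ^ k) j b₁ b₂ -
          clKer (P := P) ((P.eta k) ^ P.d) ((P.L : ℝ) ^ k) (r / 4) j b₁ b₂) b₁ b₂| ≤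
        (ℓ ^ (P.d - 2) * MC * Real.exp (-(δC / 4 * r))) * Real.exp (-(δC * (supDist b₁.src b₂.src : ℝ))) := by
    intro b₁ b₂
    have h := abs_cKer_sub_clKer_ambient_le hd hjk (δC := δC) (ε := MC * Real.exp (-(δC / 4 * r))) (R := r / 4)
      (fun b₁ b₂ => (hCd b₁ b₂).trans (le_of_eq (by ring))) b₁ b₂
    refine h.trans (le_of_eq ?_)
    rw [hℓ]; ring
  -- the three telescoped products
  have hM' : 0 ≤ lam0 * Real.exp (-(δ / 2 * (r / 16))) := by positivity
  have hMC1 : 0 ≤ MC * ℓ ^ (P.d - 2) := by positivity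
  have hMC3 : 0 ≤ ℓ ^ (P.d - 2) * MC * Real.exp (-(δC / 4 * r)) := by positivity
  have hR1 : 0 ≤ 2 * ℓ * M := by positivity
  have hR3 : 0 ≤ 2 * ℓ * (M * (1 + 16 * C / ρ₀) * Real.exp (δ / 2) * Real.exp (-(δ / 2 * (r / 16)))) := by positivity
  have t1 := abs_triple_vec_le hj hδ2 hδC hM' hR1 hMC1 hΛd hc1 hr1
  have t2 := abs_triple_vec_le hj hδ2 hδC hlam0 hR1 hMC3 hΛl hc3 hr1
  have t3 := abs_triple_vec_le hj hδ2 hδC hlam0 hR3 hMC1 hΛl hc2 hr3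
  -- split the integrand
  have hsplit : (∑ b₁ : PBond P j, ∑ b₂ : PBond P j,
        (Λ b₁ * cKer (P := P) ((P.eta k) ^ P.d) ((P.L : ℝ) ^ k) j b₁ b₂ *
            curl ((P.L : ℝ) ^ k) (fun b'' : PBond P 0 => hKer (P := P) ((P.eta k) ^ P.d) ((P.L : ℝ) ^ k) j b'' b₂) p -
          Λl b₁ * clKer (P := P) ((P.eta k) ^ P.d) ((P.L : ℝ) ^ k) (r / 4) j b₁ b₂ *
            curl ((P.L : ℝ) ^ k)
              (fun b'' : PBond P 0 => hlKer (P := P) ((P.eta k) ^ P.d) ((P.L : ℝ) ^ k) (r / 16) (r / 8) j b'' b₂) p)) =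
      (∑ b₁ : PBond P j, ∑ b₂ : PBond P j,
        (fun b₁ : PBond P j => Λ b₁ - Λl b₁) b₁ *
          cKer (P := P) ((P.eta k) ^ P.d) ((P.L : ℝ) ^ k) j b₁ b₂ *
          curl ((P.L : ℝ) ^ k) (fun b'' : PBond P 0 => hKer (P := P) ((P.eta k) ^ P.d) ((P.L : ℝ) ^ k) j b'' b₂) p) +
      (∑ b₁ : PBond P j, ∑ b₂ : PBond P j,
        Λl b₁ *
          (fun b₁ b₂ : PBond P j => cKer (P := P) ((P.eta k) ^ P.d) ((P.L : ℝ) ^ k) j b₁ b₂ -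
            clKer (P := P) ((P.eta k) ^ P.d) ((P.L : ℝ) ^ k) (r / 4) j b₁ b₂) b₁ b₂ *
          curl ((P.L : ℝ) ^ k) (fun b'' : PBond P 0 => hKer (P := P) ((P.eta k) ^ P.d) ((P.L : ℝ) ^ k) j b'' b₂) p) +
      (∑ b₁ : PBond P j, ∑ b₂ : PBond P j,
        Λl b₁ *
          clKer (P := P) ((P.eta k) ^ P.d) ((P.L : ℝ) ^ k) (r / 4) j b₁ b₂ *
          (fun b₂ : PBond P j =>
            curl ((P.L : ℝ) ^ k) (fun b'' : PBond P 0 => hKer (P := P) ((P.eta k) ^ P.d) ((P.L : ℝ) ^ k) j b'' b₂) p -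
              curl ((P.L : ℝ) ^ k)
                (fun b'' : PBond P 0 => hlKer (P := P) ((P.eta k) ^ P.d) ((P.L : ℝ) ^ k) (r / 16) (r / 8) j b'' b₂) p) b₂) := by
    rw [← Finset.sum_add_distrib, ← Finset.sum_add_distrib]
    refine Finset.sum_congr rfl fun b₁ _ => ?_
    rw [← Finset.sum_add_distrib, ← Finset.sum_add_distrib]
    refine Finset.sum_congr rfl fun b₂ _ => ?_
    exact telescope _ _ _ _ _ _
  rw [hsplit]
  refine (abs_add_three _ _ _).trans ?_
  refine (add_le_add (add_le_add t1 t2) t3).trans (le_of_eq ?_)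
  have hpow : ℓ ^ (P.d - 2) * ℓ = ℓ ^ (P.d - 1) := pow_dm2_mul hd ℓ
  rw [← hpow]
  ring

/-- **THE SCALE-`j` INTEGRAND AT ONE FACE PLAQUETTE** (the instance `Λ = H_j(b,·)`, `Λ_l = H_{j,loc}(b,·)`, `λ₀ = M`, anchor `b₋`, of
`abs_faceTerm_left_le`; (2.5), (2.7) for the rows: p08's `abs_hlKer_le_of_sup`, `abs_hKer_sub_hlKer_le`):
`|Σ_{b₁,b₂}[H_j(b,b₁)C^{(j),L^jη}(b₁,b₂)(∂^ηH_j(·,b₂))(p) − H_{j,loc}(b,b₁)C^{(j),L^jη}_{loc}(b₁,b₂)(∂^ηH_{j,loc}(·,b₂))(p)]| ≤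
S(r)·2M²M_C·(L^{k−j})^{d−1}·d²e^{a/2}K(a)²·e^{−a|b₋−p₋|_∞/L^j}`. [cite: BalabanImbrieJaffe1988, (5.4.3) p.282] -/
theorem abs_faceTerm_le (hd : 2 ≤ P.d) {k j : ℕ} (hj : j ≤ P.m + P.K) (hjk : j ≤ k) {a : ℝ} (ha : 0 < a)
    {δ M δC MC : ℝ} (hδ : 0 < δ) (hδC : 0 < δC) (hM : 0 ≤ M) (hMC : 0 ≤ MC)
    (hH : ∀ (μ ν : Fin P.d) (x : TSite P 0) (y : TSite P j),
      |(torusRep P j (deltaAData hj a)).H (x, μ) (y, ν)| ≤ M * Real.exp (-(δ * distEU P j x y)))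
    (hB : ∀ (μ ν : Fin P.d) (x : TSite P 0) (y : TSite P j),
      ‖fun lam : Fin P.d => (P.L : ℝ) ^ j *
          ((torusRep P j (deltaAData hj a)).H (x.shift lam, μ) (y, ν) - (torusRep P j (deltaAData hj a)).H (x, μ) (y, ν))‖ ≤
        M * Real.exp (-(δ * distEU P j x y)))
    {C : ℝ} (hC0 : 0 ≤ C) (hCζ : ∀ (R₁ R₀ : ℝ), R₁ < R₀ → ∀ t s : ℝ,
      |cutoffProfile R₁ R₀ t - cutoffProfile R₁ R₀ s| ≤ C / (R₀ - R₁) * |t - s|)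
    {r ρ₀ : ℝ} (hρ₀ : 0 < ρ₀) (hr : ρ₀ ≤ r)
    (hCm : ∀ b₁ b₂ : PBond P j, |Cmat P j b₁ b₂| ≤ MC * Real.exp (-(δC * (supDist b₁.src b₂.src : ℝ))))
    (hCl : ∀ b₁ b₂ : PBond P j, |Cloc P j (r / 4) b₁ b₂| ≤ MC * Real.exp (-(δC * (supDist b₁.src b₂.src : ℝ))))
    (hCd : ∀ b₁ b₂ : PBond P j, |Cloc P j (r / 4) b₁ b₂ - Cmat P j b₁ b₂| ≤
      MC * Real.exp (-(δC / 4 * r)) * Real.exp (-(δC * (supDist b₁.src b₂.src : ℝ))))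
    (b : PBond P 0) (p : TPlaq P 0) :
    |∑ b₁ : PBond P j, ∑ b₂ : PBond P j,
        (hKer (P := P) ((P.eta k) ^ P.d) ((P.L : ℝ) ^ k) j b b₁ * cKer (P := P) ((P.eta k) ^ P.d) ((P.L : ℝ) ^ k) j b₁ b₂ *
            curl ((P.L : ℝ) ^ k) (fun b'' : PBond P 0 => hKer (P := P) ((P.eta k) ^ P.d) ((P.L : ℝ) ^ k) j b'' b₂) p -
          hlKer (P := P) ((P.eta k) ^ P.d) ((P.L : ℝ) ^ k) (r / 16) (r / 8) j b b₁ *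
              clKer (P := P) ((P.eta k) ^ P.d) ((P.L : ℝ) ^ k) (r / 4) j b₁ b₂ *
            curl ((P.L : ℝ) ^ k)
              (fun b'' : PBond P 0 => hlKer (P := P) ((P.eta k) ^ P.d) ((P.L : ℝ) ^ k) (r / 16) (r / 8) j b'' b₂) p)| ≤
      (Real.exp (-(δ / 2 * (r / 16))) + Real.exp (-(δC / 4 * r)) + (1 + 16 * C / ρ₀) * Real.exp (δ / 2) * Real.exp (-(δ / 2 * (r / 16)))) *
        (2 * M ^ 2 * MC * ((P.L : ℝ) ^ (k - j)) ^ (P.d - 1) * ((P.d : ℝ) ^ 2 *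
          (Real.exp (min (δ / 2) δC / 2 / 2) * ((2 * (1 + P.d / (min (δ / 2) δC / 2))) ^ P.d) ^ 2))) *
        Real.exp (-(min (δ / 2) δC / 2 * ((supDist b.src p.src : ℝ) / (P.L : ℝ) ^ j))) := by
  have hR : r / 16 < r / 8 := by linarith [lt_of_lt_of_le hρ₀ hr]
  have hw : 0 < (P.eta k) ^ P.d := pow_pos (eta_pos P k) _
  have hc : (P.L : ℝ) ^ k ≠ 0 := (cast_pow_L_pos' k).ne'
  have weaken : ∀ (x : TSite P 0) (y : TSite P j),
      M * Real.exp (-(δ * distEU P j x y)) ≤ M * Real.exp (-(δ / 2 * distEU P j x y)) := by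
    intro x y
    refine mul_le_mul_of_nonneg_left (Real.exp_le_exp.2 ?_) hM
    have h0 : 0 ≤ distEU P j x y := div_nonneg (Nat.cast_nonneg _) (cast_pow_L_pos' j).le
    nlinarith
  have hhl : ∀ b₁ : PBond P j, |hlKer (P := P) ((P.eta k) ^ P.d) ((P.L : ℝ) ^ k) (r / 16) (r / 8) j b b₁| ≤
      M * Real.exp (-(δ / 2 * distEU P j b.src b₁.src)) :=
    fun b₁ => (abs_hlKer_le_of_sup hj hw hc ha hH (r / 16) (r / 8) b b₁).trans (weaken _ _)
  have hhd : ∀ b₁ : PBond P j, |hKer (P := P) ((P.eta k) ^ P.d) ((P.L : ℝ) ^ k) j b b₁ -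
      hlKer (P := P) ((P.eta k) ^ P.d) ((P.L : ℝ) ^ k) (r / 16) (r / 8) j b b₁| ≤
        M * Real.exp (-(δ / 2 * (r / 16))) * Real.exp (-(δ / 2 * distEU P j b.src b₁.src)) :=
    fun b₁ => abs_hKer_sub_hlKer_le hj hw hc ha hδ.le hH hR b b₁
  refine (abs_faceTerm_left_le hd hj hjk ha hδ hδC hM hMC hH hB hC0 hCζ hρ₀ hr hCm hCl hCd hM hhl hhd p).trans (le_of_eq ?_)
  ring

/-! ## §4  The scale-`j` term `T_j(b, p′)`: the face average -/

/-- **the decay reaches the unit plaquette**: for a face plaquette `p ∈ B^e_k(p′)` and `j ≤ k`, `a ≥ 0`,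
`e^{−a|b₋−p₋|_∞/L^j} ≤ e^{a/2}·e^{−a·dist_k(b₋, p′₋)}` (`|p₋ − y_{p′₋}|_∞ ≤ (L^k−1)/2`, `L^j ≤ L^k`). [cite: BalabanImbrieJaffe1985, (2.21) p.305] -/
theorem exp_face_le (hd : 2 ≤ P.d) {k j : ℕ} (hk : k ≤ P.m + P.K) (hjk : j ≤ k) {a : ℝ} (ha : 0 ≤ a) {p' : TPlaq P k} {p : TPlaq P 0}
    (hp : p ∈ (edgeGeo P hd k).B p') (x : TSite P 0) :
    Real.exp (-(a * ((supDist x p.src : ℝ) / (P.L : ℝ) ^ j))) ≤ Real.exp (a / 2) * Real.exp (-(a * distEU P k x p'.src)) := by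
  have hLk : 0 < (P.L : ℝ) ^ k := cast_pow_L_pos' k
  have hLj : 0 < (P.L : ℝ) ^ j := cast_pow_L_pos' j
  have hjk' : (P.L : ℝ) ^ j ≤ (P.L : ℝ) ^ k := pow_le_pow_right₀ (by exact_mod_cast P.L_pos) hjk
  have h1 : (supDist x p.src : ℝ) / (P.L : ℝ) ^ k ≤ (supDist x p.src : ℝ) / (P.L : ℝ) ^ j :=
    div_le_div_of_nonneg_left (Nat.cast_nonneg _) hLj hjk'
  have h2 := supDist_ctr_le_of_mem hd hk hp
  have h3 : (supDist p.src (ctr k p'.src) : ℝ) ≤ (P.L : ℝ) ^ k / 2 := by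
    have h3a : (supDist p.src (ctr k p'.src) : ℝ) ≤ (((P.L ^ k - 1) / 2 : ℕ) : ℝ) := by exact_mod_cast h2
    have h3b : (((P.L ^ k - 1) / 2 : ℕ) : ℝ) ≤ ((P.L ^ k - 1 : ℕ) : ℝ) / 2 := Nat.cast_div_le
    have h3c : ((P.L ^ k - 1 : ℕ) : ℝ) ≤ (P.L : ℝ) ^ k := by
      have : P.L ^ k - 1 ≤ P.L ^ k := Nat.sub_le _ _
      exact_mod_cast this
    linarith
  have h4 : distEU P k x p'.src ≤ (supDist x p.src : ℝ) / (P.L : ℝ) ^ k + 1 / 2 := by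
    rw [distEU, div_add' _ _ _ hLk.ne', div_le_div_iff_of_pos_right hLk]
    have h := supDist_triangle x p.src (ctr k p'.src)
    have h' : (supDist x (ctr k p'.src) : ℝ) ≤ (supDist x p.src : ℝ) + (supDist p.src (ctr k p'.src) : ℝ) := by exact_mod_cast h
    linarith
  rw [← Real.exp_add]
  exact Real.exp_le_exp.2 (by nlinarith)

/-- **THE LEFT-ABSTRACTED PAIR AS A FACE AVERAGE**: `Σ_{b₁,b₂}[Λ(b₁)C^{(j)}(b₁,b₂)G_j(b₂;p′) − Λ_l(b₁)C^{(j)}_{loc}(b₁,b₂)G_{j,loc}(b₂;p′)] =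
(L^k)^{−(d−2)}Σ_{p∈B^e_k(p′)}Σ_{b₁,b₂}[Λ(b₁)C^{(j)}(b₁,b₂)(∂^ηH_j(·,b₂))(p) − Λ_l(b₁)C^{(j)}_{loc}(b₁,b₂)(∂^ηH_{j,loc}(·,b₂))(p)]` (file 1's
`tT_eq_face_sum` with the row abstracted). [cite: BalabanImbrieJaffe1985, (2.21) p.305] -/
theorem leftPair_eq_face_sum (hd : 2 ≤ P.d) {k : ℕ} (ρ : ℕ → ℝ) (j : ℕ) (Λ Λl : PBond P j → ℝ) (p' : TPlaq P k) :
    ∑ b₁ : PBond P j, ∑ b₂ : PBond P j,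
        (Λ b₁ * cKer (P := P) ((P.eta k) ^ P.d) ((P.L : ℝ) ^ k) j b₁ b₂ * gT hd k j b₂ p' -
          Λl b₁ * clKer (P := P) ((P.eta k) ^ P.d) ((P.L : ℝ) ^ k) (ρ j / 4) j b₁ b₂ * glT hd ρ k j b₂ p') =
      (((P.L : ℝ) ^ k) ^ (P.d - 2))⁻¹ * ∑ p ∈ (edgeGeo P hd k).B p', ∑ b₁ : PBond P j, ∑ b₂ : PBond P j,
        (Λ b₁ * cKer (P := P) ((P.eta k) ^ P.d) ((P.L : ℝ) ^ k) j b₁ b₂ *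
            curl ((P.L : ℝ) ^ k) (fun b'' : PBond P 0 => hKer (P := P) ((P.eta k) ^ P.d) ((P.L : ℝ) ^ k) j b'' b₂) p -
          Λl b₁ * clKer (P := P) ((P.eta k) ^ P.d) ((P.L : ℝ) ^ k) (ρ j / 4) j b₁ b₂ *
            curl ((P.L : ℝ) ^ k)
              (fun b'' : PBond P 0 => hlKer (P := P) ((P.eta k) ^ P.d) ((P.L : ℝ) ^ k) (ρ j / 16) (ρ j / 8) j b'' b₂) p) := by
  simp only [gT_eq_face_sum, glT_eq_face_sum]
  set Cst : ℝ := (((P.L : ℝ) ^ k) ^ (P.d - 2))⁻¹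
  calc _ = ∑ b₁ : PBond P j, ∑ b₂ : PBond P j, ∑ p ∈ (edgeGeo P hd k).B p', Cst *
        (Λ b₁ * cKer (P := P) ((P.eta k) ^ P.d) ((P.L : ℝ) ^ k) j b₁ b₂ *
            curl ((P.L : ℝ) ^ k) (fun b'' : PBond P 0 => hKer (P := P) ((P.eta k) ^ P.d) ((P.L : ℝ) ^ k) j b'' b₂) p -
          Λl b₁ * clKer (P := P) ((P.eta k) ^ P.d) ((P.L : ℝ) ^ k) (ρ j / 4) j b₁ b₂ *
            curl ((P.L : ℝ) ^ k)
              (fun b'' : PBond P 0 => hlKer (P := P) ((P.eta k) ^ P.d) ((P.L : ℝ) ^ k) (ρ j / 16) (ρ j / 8) j b'' b₂) p) := by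
        refine Finset.sum_congr rfl fun b₁ _ => Finset.sum_congr rfl fun b₂ _ => ?_
        rw [Finset.mul_sum, Finset.mul_sum, Finset.mul_sum, Finset.mul_sum, ← Finset.sum_sub_distrib]
        exact Finset.sum_congr rfl fun p _ => by ring
    _ = ∑ p ∈ (edgeGeo P hd k).B p', ∑ b₁ : PBond P j, ∑ b₂ : PBond P j, Cst *
        (Λ b₁ * cKer (P := P) ((P.eta k) ^ P.d) ((P.L : ℝ) ^ k) j b₁ b₂ *
            curl ((P.L : ℝ) ^ k) (fun b'' : PBond P 0 => hKer (P := P) ((P.eta k) ^ P.d) ((P.L : ℝ) ^ k) j b'' b₂) p -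
          Λl b₁ * clKer (P := P) ((P.eta k) ^ P.d) ((P.L : ℝ) ^ k) (ρ j / 4) j b₁ b₂ *
            curl ((P.L : ℝ) ^ k)
              (fun b'' : PBond P 0 => hlKer (P := P) ((P.eta k) ^ P.d) ((P.L : ℝ) ^ k) (ρ j / 16) (ρ j / 8) j b'' b₂) p) := by
        calc _ = ∑ b₁ : PBond P j, ∑ p ∈ (edgeGeo P hd k).B p', ∑ b₂ : PBond P j, Cst *
              (Λ b₁ * cKer (P := P) ((P.eta k) ^ P.d) ((P.L : ℝ) ^ k) j b₁ b₂ *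
                  curl ((P.L : ℝ) ^ k) (fun b'' : PBond P 0 => hKer (P := P) ((P.eta k) ^ P.d) ((P.L : ℝ) ^ k) j b'' b₂) p -
                Λl b₁ * clKer (P := P) ((P.eta k) ^ P.d) ((P.L : ℝ) ^ k) (ρ j / 4) j b₁ b₂ *
                  curl ((P.L : ℝ) ^ k)
                    (fun b'' : PBond P 0 => hlKer (P := P) ((P.eta k) ^ P.d) ((P.L : ℝ) ^ k) (ρ j / 16) (ρ j / 8) j b'' b₂) p) :=
            Finset.sum_congr rfl fun b₁ _ => Finset.sum_comm
          _ = _ := Finset.sum_comm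
    _ = _ := by
        rw [Finset.mul_sum]
        refine Finset.sum_congr rfl fun p _ => ?_
        rw [Finset.mul_sum]
        refine Finset.sum_congr rfl fun b₁ _ => ?_
        rw [Finset.mul_sum]

/-- **THE SCALE-`j` FACE AVERAGE, LEFT FACTOR ABSTRACTED** (hypotheses of `abs_faceTerm_left_le` along a radius schedule `ρ` with `ρ_j ≥ ρ₀`, and
`k ≤ m + K`; the interface for p08's `∂T_j`, `∂*T_j`):
`|Σ_{b₁,b₂}[Λ(b₁)C^{(j),L^jη}(b₁,b₂)G_j(b₂;p′) − Λ_l(b₁)C^{(j),L^jη}_{loc}(b₁,b₂)G_{j,loc}(b₂;p′)]| ≤ S(ρ_j)·2λ₀MM_C(L^{k−j})^{d−1}d²e^{a/2}K(a)²·e^{a/2}·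
e^{−a·dist_k(x₁,p′₋)}` — the face average over the `(L^k)^{d−2}` plaquettes of `B^e_k(p′)` (`card_edgeBTo`) against the `(L^k)^{−(d−2)}` of `Q^e_k`
(crude face count: `(L^{k−j})^{d−1}` where the print's «+(d−2)» gives `(L^{k−j})^{1}`; immaterial for the resummation).
[cite: BalabanImbrieJaffe1988, (5.4.3) p.282] -/
theorem abs_leftFace_le (hd : 2 ≤ P.d) {k j : ℕ} (hk : k ≤ P.m + P.K) (hj : j ≤ P.m + P.K) (hjk : j ≤ k) {a : ℝ} (ha : 0 < a)
    {δ M δC MC : ℝ} (hδ : 0 < δ) (hδC : 0 < δC) (hM : 0 ≤ M) (hMC : 0 ≤ MC)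
    (hH : ∀ (μ ν : Fin P.d) (x : TSite P 0) (y : TSite P j),
      |(torusRep P j (deltaAData hj a)).H (x, μ) (y, ν)| ≤ M * Real.exp (-(δ * distEU P j x y)))
    (hB : ∀ (μ ν : Fin P.d) (x : TSite P 0) (y : TSite P j),
      ‖fun lam : Fin P.d => (P.L : ℝ) ^ j *
          ((torusRep P j (deltaAData hj a)).H (x.shift lam, μ) (y, ν) - (torusRep P j (deltaAData hj a)).H (x, μ) (y, ν))‖ ≤
        M * Real.exp (-(δ * distEU P j x y)))
    {C : ℝ} (hC0 : 0 ≤ C) (hCζ : ∀ (R₁ R₀ : ℝ), R₁ < R₀ → ∀ t s : ℝ,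
      |cutoffProfile R₁ R₀ t - cutoffProfile R₁ R₀ s| ≤ C / (R₀ - R₁) * |t - s|)
    (ρ : ℕ → ℝ) {ρ₀ : ℝ} (hρ₀ : 0 < ρ₀) (hr : ρ₀ ≤ ρ j)
    (hCm : ∀ b₁ b₂ : PBond P j, |Cmat P j b₁ b₂| ≤ MC * Real.exp (-(δC * (supDist b₁.src b₂.src : ℝ))))
    (hCl : ∀ b₁ b₂ : PBond P j, |Cloc P j (ρ j / 4) b₁ b₂| ≤ MC * Real.exp (-(δC * (supDist b₁.src b₂.src : ℝ))))
    (hCd : ∀ b₁ b₂ : PBond P j, |Cloc P j (ρ j / 4) b₁ b₂ - Cmat P j b₁ b₂| ≤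
      MC * Real.exp (-(δC / 4 * ρ j)) * Real.exp (-(δC * (supDist b₁.src b₂.src : ℝ))))
    {Λ Λl : PBond P j → ℝ} {x₁ : TSite P 0} {lam0 : ℝ} (hlam0 : 0 ≤ lam0)
    (hΛl : ∀ b₁ : PBond P j, |Λl b₁| ≤ lam0 * Real.exp (-(δ / 2 * distEU P j x₁ b₁.src)))
    (hΛd : ∀ b₁ : PBond P j, |Λ b₁ - Λl b₁| ≤ lam0 * Real.exp (-(δ / 2 * (ρ j / 16))) * Real.exp (-(δ / 2 * distEU P j x₁ b₁.src)))
    (p' : TPlaq P k) :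
    |∑ b₁ : PBond P j, ∑ b₂ : PBond P j,
        (Λ b₁ * cKer (P := P) ((P.eta k) ^ P.d) ((P.L : ℝ) ^ k) j b₁ b₂ * gT hd k j b₂ p' -
          Λl b₁ * clKer (P := P) ((P.eta k) ^ P.d) ((P.L : ℝ) ^ k) (ρ j / 4) j b₁ b₂ * glT hd ρ k j b₂ p')| ≤
      (Real.exp (-(δ / 2 * (ρ j / 16))) + Real.exp (-(δC / 4 * ρ j)) +
          (1 + 16 * C / ρ₀) * Real.exp (δ / 2) * Real.exp (-(δ / 2 * (ρ j / 16)))) *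
        (2 * lam0 * M * MC * ((P.L : ℝ) ^ (k - j)) ^ (P.d - 1) * ((P.d : ℝ) ^ 2 *
          (Real.exp (min (δ / 2) δC / 2 / 2) * ((2 * (1 + P.d / (min (δ / 2) δC / 2))) ^ P.d) ^ 2))) *
        (Real.exp (min (δ / 2) δC / 2 / 2) * Real.exp (-(min (δ / 2) δC / 2 * distEU P k x₁ p'.src))) := by
  have hLk : 0 < ((P.L : ℝ) ^ k) ^ (P.d - 2) := pow_pos (cast_pow_L_pos' k) _
  have ha₀ : 0 ≤ min (δ / 2) δC / 2 := (half_pos (lt_min (half_pos hδ) hδC)).le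
  set S : ℝ := (Real.exp (-(δ / 2 * (ρ j / 16))) + Real.exp (-(δC / 4 * ρ j)) +
      (1 + 16 * C / ρ₀) * Real.exp (δ / 2) * Real.exp (-(δ / 2 * (ρ j / 16)))) *
    (2 * lam0 * M * MC * ((P.L : ℝ) ^ (k - j)) ^ (P.d - 1) * ((P.d : ℝ) ^ 2 *
      (Real.exp (min (δ / 2) δC / 2 / 2) * ((2 * (1 + P.d / (min (δ / 2) δC / 2))) ^ P.d) ^ 2))) with hS
  have hS0 : 0 ≤ S := by positivity
  set E' : ℝ := Real.exp (min (δ / 2) δC / 2 / 2) * Real.exp (-(min (δ / 2) δC / 2 * distEU P k x₁ p'.src)) with hE'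
  have hface : ∀ p ∈ (edgeGeo P hd k).B p', |∑ b₁ : PBond P j, ∑ b₂ : PBond P j,
        (Λ b₁ * cKer (P := P) ((P.eta k) ^ P.d) ((P.L : ℝ) ^ k) j b₁ b₂ *
            curl ((P.L : ℝ) ^ k) (fun b'' : PBond P 0 => hKer (P := P) ((P.eta k) ^ P.d) ((P.L : ℝ) ^ k) j b'' b₂) p -
          Λl b₁ * clKer (P := P) ((P.eta k) ^ P.d) ((P.L : ℝ) ^ k) (ρ j / 4) j b₁ b₂ *
            curl ((P.L : ℝ) ^ k)
              (fun b'' : PBond P 0 => hlKer (P := P) ((P.eta k) ^ P.d) ((P.L : ℝ) ^ k) (ρ j / 16) (ρ j / 8) j b'' b₂) p)| ≤ S * E' := by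
    intro p hp
    refine (abs_faceTerm_left_le hd hj hjk ha hδ hδC hM hMC hH hB hC0 hCζ hρ₀ hr hCm hCl hCd hlam0 hΛl hΛd p).trans ?_
    rw [← hS]
    exact mul_le_mul_of_nonneg_left (exp_face_le hd hk hjk ha₀ hp x₁) hS0
  rw [leftPair_eq_face_sum, abs_mul, abs_inv, abs_of_pos hLk]
  calc (((P.L : ℝ) ^ k) ^ (P.d - 2))⁻¹ * |∑ p ∈ (edgeGeo P hd k).B p', _|
      ≤ (((P.L : ℝ) ^ k) ^ (P.d - 2))⁻¹ * ∑ p ∈ (edgeGeo P hd k).B p', S * E' :=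
        mul_le_mul_of_nonneg_left ((Finset.abs_sum_le_sum_abs _ _).trans (Finset.sum_le_sum hface)) (inv_nonneg.2 hLk.le)
    _ = (((P.L : ℝ) ^ k) ^ (P.d - 2))⁻¹ * (((edgeGeo P hd k).B p').card * (S * E')) := by rw [Finset.sum_const, nsmul_eq_mul]
    _ = S * E' := by
        have hcard : (((edgeGeo P hd k).B p').card : ℝ) = ((P.L : ℝ) ^ k) ^ (P.d - 2) := by
          rw [show ((edgeGeo P hd k).B p').card = (P.L ^ k) ^ (P.d - 2) from card_edgeBTo (Nat.zero_add k) hk hd p']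
          push_cast; ring
        rw [hcard, ← mul_assoc, inv_mul_cancel₀ hLk.ne', one_mul]

/-- **THE SCALE-`j` TERM `T_j(b, p′)`** (the instance `Λ = H_j(b,·)`, `Λ_l = H_{j,loc}(b,·)`, `λ₀ = M`, anchor `b₋`, of `abs_leftFace_le`):
`|T_j(b,p′)| ≤ S(ρ_j)·2M²M_C(L^{k−j})^{d−1}d²e^{a/2}K(a)²·e^{a/2}·e^{−a·dist_k(b₋,p′₋)}`. [cite: BalabanImbrieJaffe1988, (5.4.3) p.282] -/
theorem abs_tT_le (hd : 2 ≤ P.d) {k j : ℕ} (hk : k ≤ P.m + P.K) (hj : j ≤ P.m + P.K) (hjk : j ≤ k) {a : ℝ} (ha : 0 < a)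
    {δ M δC MC : ℝ} (hδ : 0 < δ) (hδC : 0 < δC) (hM : 0 ≤ M) (hMC : 0 ≤ MC)
    (hH : ∀ (μ ν : Fin P.d) (x : TSite P 0) (y : TSite P j),
      |(torusRep P j (deltaAData hj a)).H (x, μ) (y, ν)| ≤ M * Real.exp (-(δ * distEU P j x y)))
    (hB : ∀ (μ ν : Fin P.d) (x : TSite P 0) (y : TSite P j),
      ‖fun lam : Fin P.d => (P.L : ℝ) ^ j *
          ((torusRep P j (deltaAData hj a)).H (x.shift lam, μ) (y, ν) - (torusRep P j (deltaAData hj a)).H (x, μ) (y, ν))‖ ≤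
        M * Real.exp (-(δ * distEU P j x y)))
    {C : ℝ} (hC0 : 0 ≤ C) (hCζ : ∀ (R₁ R₀ : ℝ), R₁ < R₀ → ∀ t s : ℝ,
      |cutoffProfile R₁ R₀ t - cutoffProfile R₁ R₀ s| ≤ C / (R₀ - R₁) * |t - s|)
    (ρ : ℕ → ℝ) {ρ₀ : ℝ} (hρ₀ : 0 < ρ₀) (hr : ρ₀ ≤ ρ j)
    (hCm : ∀ b₁ b₂ : PBond P j, |Cmat P j b₁ b₂| ≤ MC * Real.exp (-(δC * (supDist b₁.src b₂.src : ℝ))))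
    (hCl : ∀ b₁ b₂ : PBond P j, |Cloc P j (ρ j / 4) b₁ b₂| ≤ MC * Real.exp (-(δC * (supDist b₁.src b₂.src : ℝ))))
    (hCd : ∀ b₁ b₂ : PBond P j, |Cloc P j (ρ j / 4) b₁ b₂ - Cmat P j b₁ b₂| ≤
      MC * Real.exp (-(δC / 4 * ρ j)) * Real.exp (-(δC * (supDist b₁.src b₂.src : ℝ))))
    (b : PBond P 0) (p' : TPlaq P k) :
    |tT hd ρ k j b p'| ≤
      (Real.exp (-(δ / 2 * (ρ j / 16))) + Real.exp (-(δC / 4 * ρ j)) +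
          (1 + 16 * C / ρ₀) * Real.exp (δ / 2) * Real.exp (-(δ / 2 * (ρ j / 16)))) *
        (2 * M ^ 2 * MC * ((P.L : ℝ) ^ (k - j)) ^ (P.d - 1) * ((P.d : ℝ) ^ 2 *
          (Real.exp (min (δ / 2) δC / 2 / 2) * ((2 * (1 + P.d / (min (δ / 2) δC / 2))) ^ P.d) ^ 2))) *
        (Real.exp (min (δ / 2) δC / 2 / 2) * Real.exp (-(min (δ / 2) δC / 2 * distEU P k b.src p'.src))) := by
  have hR : ρ j / 16 < ρ j / 8 := by linarith [lt_of_lt_of_le hρ₀ hr]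
  have hw : 0 < (P.eta k) ^ P.d := pow_pos (eta_pos P k) _
  have hc : (P.L : ℝ) ^ k ≠ 0 := (cast_pow_L_pos' k).ne'
  have weaken : ∀ (x : TSite P 0) (y : TSite P j),
      M * Real.exp (-(δ * distEU P j x y)) ≤ M * Real.exp (-(δ / 2 * distEU P j x y)) := by
    intro x y
    refine mul_le_mul_of_nonneg_left (Real.exp_le_exp.2 ?_) hM
    have h0 : 0 ≤ distEU P j x y := div_nonneg (Nat.cast_nonneg _) (cast_pow_L_pos' j).le
    nlinarith
  have hhl : ∀ b₁ : PBond P j, |hlKer (P := P) ((P.eta k) ^ P.d) ((P.L : ℝ) ^ k) (ρ j / 16) (ρ j / 8) j b b₁| ≤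
      M * Real.exp (-(δ / 2 * distEU P j b.src b₁.src)) :=
    fun b₁ => (abs_hlKer_le_of_sup hj hw hc ha hH (ρ j / 16) (ρ j / 8) b b₁).trans (weaken _ _)
  have hhd : ∀ b₁ : PBond P j, |hKer (P := P) ((P.eta k) ^ P.d) ((P.L : ℝ) ^ k) j b b₁ -
      hlKer (P := P) ((P.eta k) ^ P.d) ((P.L : ℝ) ^ k) (ρ j / 16) (ρ j / 8) j b b₁| ≤
        M * Real.exp (-(δ / 2 * (ρ j / 16))) * Real.exp (-(δ / 2 * distEU P j b.src b₁.src)) :=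
    fun b₁ => abs_hKer_sub_hlKer_le hj hw hc ha hδ.le hH hR b b₁
  unfold tT
  refine (abs_leftFace_le hd hk hj hjk ha hδ hδC hM hMC hH hB hC0 hCζ ρ hρ₀ hr hCm hCl hCd hM hhl hhd p').trans (le_of_eq ?_)
  ring

/-! ## §5  The sum over scales: growing factors against the radius schedule -/

/-- `Σ_{j<k} q^{k−j} ≤ 1` for `0 ≤ q ≤ ½`. [folklore] -/
private theorem sum_pow_sub_le_one {q : ℝ} (hq0 : 0 ≤ q) (hq : q ≤ 1 / 2) (k : ℕ) :
    ∑ j ∈ Finset.range k, q ^ (k - j) ≤ 1 := by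
  induction k with
  | zero => simp
  | succ k ih =>
    have e : ∑ j ∈ Finset.range (k + 1), q ^ (k + 1 - j) = q * ∑ j ∈ Finset.range k, q ^ (k - j) + q := by
      rw [Finset.sum_range_succ, show k + 1 - k = 1 by omega, pow_one, Finset.mul_sum]
      refine congrArg (· + q) (Finset.sum_congr rfl fun j hj => ?_)
      rw [show k + 1 - j = (k - j) + 1 by have := Finset.mem_range.1 hj; omega, pow_succ, mul_comm]
    rw [e]
    have h0 : 0 ≤ ∑ j ∈ Finset.range k, q ^ (k - j) := Finset.sum_nonneg fun j _ => pow_nonneg hq0 _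
    nlinarith

/-- **RESUMMATION WITH GROWING SCALE FACTORS** (the mechanism of print's second inequality «Σ_{j=1}^{k−1}(L^jη)^{−…}e^{−cr(e_j)} ≦ e^{−cr(e_k)}»,
p08 g4's `smallness_sum_le` for `j` from `0`): if `ρ_j ≥ ρ_k + (k−j)θ` for `j < k` and `Λe^{−cθ} ≤ ½` (`Λ, c ≥ 0`), then
`Σ_{j<k}Λ^{k−j}e^{−cρ_j} ≤ e^{−cρ_k}`. [cite: BalabanImbrieJaffe1988, (5.4.3) p.282] -/
theorem sum_pow_smallness_le {Λ c θ : ℝ} (hΛ : 0 ≤ Λ) (hc : 0 ≤ c) (hq : Λ * Real.exp (-(c * θ)) ≤ 1 / 2) {k : ℕ} {ρ : ℕ → ℝ}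
    (hgap : ∀ j < k, ρ k + ((k - j : ℕ) : ℝ) * θ ≤ ρ j) :
    ∑ j ∈ Finset.range k, Λ ^ (k - j) * Real.exp (-(c * ρ j)) ≤ Real.exp (-(c * ρ k)) := by
  have hq0 : 0 ≤ Λ * Real.exp (-(c * θ)) := mul_nonneg hΛ (Real.exp_pos _).le
  have hpt : ∀ j ∈ Finset.range k, Λ ^ (k - j) * Real.exp (-(c * ρ j)) ≤ Real.exp (-(c * ρ k)) * (1 / 2) ^ (k - j) := by
    intro j hj
    have hjk := Finset.mem_range.1 hj
    have h1 : Real.exp (-(c * ρ j)) ≤ Real.exp (-(c * ρ k)) * (Real.exp (-(c * θ))) ^ (k - j) := by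
      rw [← Real.exp_nat_mul, ← Real.exp_add]
      exact Real.exp_le_exp.2 (by nlinarith [hgap j hjk, mul_le_mul_of_nonneg_left (hgap j hjk) hc])
    calc Λ ^ (k - j) * Real.exp (-(c * ρ j)) ≤ Λ ^ (k - j) * (Real.exp (-(c * ρ k)) * (Real.exp (-(c * θ))) ^ (k - j)) :=
          mul_le_mul_of_nonneg_left h1 (pow_nonneg hΛ _)
      _ = Real.exp (-(c * ρ k)) * (Λ * Real.exp (-(c * θ))) ^ (k - j) := by rw [mul_pow]; ring
      _ ≤ Real.exp (-(c * ρ k)) * (1 / 2) ^ (k - j) :=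
          mul_le_mul_of_nonneg_left (pow_le_pow_left₀ hq0 hq _) (Real.exp_pos _).le
  calc _ ≤ ∑ j ∈ Finset.range k, Real.exp (-(c * ρ k)) * (1 / 2) ^ (k - j) := Finset.sum_le_sum hpt
    _ = Real.exp (-(c * ρ k)) * ∑ j ∈ Finset.range k, (1 / 2 : ℝ) ^ (k - j) := by rw [Finset.mul_sum]
    _ ≤ Real.exp (-(c * ρ k)) * 1 :=
        mul_le_mul_of_nonneg_left (sum_pow_sub_le_one (by norm_num) le_rfl k) (Real.exp_pos _).le
    _ = _ := mul_one _

/-- the three smallness factors of one scale under a single rate: `S(ρ) ≤ (2 + (1 + 16C_σ/ρ₀)e^{δ/2})e^{−c₁ρ}`, `c₁ = min(δ/32, δ_C/4)`, `ρ ≥ 0`.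
[cite: BalabanImbrieJaffe1988, (5.4.3) p.282] -/
private theorem smallness_le {δ δC C ρ₀ ρ : ℝ} (hC : 0 ≤ 1 + 16 * C / ρ₀) (hρ : 0 ≤ ρ) :
    Real.exp (-(δ / 2 * (ρ / 16))) + Real.exp (-(δC / 4 * ρ)) + (1 + 16 * C / ρ₀) * Real.exp (δ / 2) * Real.exp (-(δ / 2 * (ρ / 16))) ≤
      (2 + (1 + 16 * C / ρ₀) * Real.exp (δ / 2)) * Real.exp (-(min (δ / 32) (δC / 4) * ρ)) := by
  have h1 : Real.exp (-(δ / 2 * (ρ / 16))) ≤ Real.exp (-(min (δ / 32) (δC / 4) * ρ)) :=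
    Real.exp_le_exp.2 (by nlinarith [min_le_left (δ / 32) (δC / 4)])
  have h2 : Real.exp (-(δC / 4 * ρ)) ≤ Real.exp (-(min (δ / 32) (δC / 4) * ρ)) :=
    Real.exp_le_exp.2 (by nlinarith [min_le_right (δ / 32) (δC / 4)])
  have h3 : (1 + 16 * C / ρ₀) * Real.exp (δ / 2) * Real.exp (-(δ / 2 * (ρ / 16))) ≤
      (1 + 16 * C / ρ₀) * Real.exp (δ / 2) * Real.exp (-(min (δ / 32) (δC / 4) * ρ)) :=
    mul_le_mul_of_nonneg_left h1 (by positivity)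
  nlinarith

/-- `(L^{k−j})^{d−1} = (L^{d−1})^{k−j}`. [folklore] -/
private theorem pow_pow_comm' (k j : ℕ) : ((P.L : ℝ) ^ (k - j)) ^ (P.d - 1) = ((P.L : ℝ) ^ (P.d - 1)) ^ (k - j) := by
  rw [← pow_mul, ← pow_mul, mul_comm]

/-- **THE SCALE SUM `Σ_{j<k} T_j(b, p′)`** (`k ≤ m + K`, `d ≥ 2`; the sup and gradient members of (I.7.2.2) for every `H_j`, p09's `C^{(j)}`
bounds, a radius schedule with `ρ_j ≥ ρ₀ > 0` and THE SCALE GAP `ρ_j ≥ ρ_k + (k−j)θ`, `L^{d−1}e^{−c₁θ} ≤ ½`, `c₁ = min(δ/32, δ_C/4)`):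
`|Σ_{j<k} T_j(b,p′)| ≤ (2 + (1+16C_σ/ρ₀)e^{δ/2})·2M²M_C d²e^{a/2}K(a)²·e^{a/2}·e^{−c₁ρ_k}·e^{−a dist_k(b₋,p′₋)}` — print's
«≦ Σ_j (L^jη)^{…}e^{−cr(e_j)}e^{−c dist} ≦ e^{−cr(e_k)}e^{−c dist}». [cite: BalabanImbrieJaffe1988, (5.4.3) p.282] -/
theorem abs_sum_tT_le (hd : 2 ≤ P.d) {k : ℕ} (hk : k ≤ P.m + P.K) {a : ℝ} (ha : 0 < a)
    {δ M δC MC : ℝ} (hδ : 0 < δ) (hδC : 0 < δC) (hM : 0 ≤ M) (hMC : 0 ≤ MC)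
    (hH : ∀ (j : ℕ) (hj : j ≤ P.m + P.K), j < k → ∀ (μ ν : Fin P.d) (x : TSite P 0) (y : TSite P j),
      |(torusRep P j (deltaAData hj a)).H (x, μ) (y, ν)| ≤ M * Real.exp (-(δ * distEU P j x y)))
    (hB : ∀ (j : ℕ) (hj : j ≤ P.m + P.K), j < k → ∀ (μ ν : Fin P.d) (x : TSite P 0) (y : TSite P j),
      ‖fun lam : Fin P.d => (P.L : ℝ) ^ j *
          ((torusRep P j (deltaAData hj a)).H (x.shift lam, μ) (y, ν) - (torusRep P j (deltaAData hj a)).H (x, μ) (y, ν))‖ ≤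
        M * Real.exp (-(δ * distEU P j x y)))
    {C : ℝ} (hC0 : 0 ≤ C) (hCζ : ∀ (R₁ R₀ : ℝ), R₁ < R₀ → ∀ t s : ℝ,
      |cutoffProfile R₁ R₀ t - cutoffProfile R₁ R₀ s| ≤ C / (R₀ - R₁) * |t - s|)
    (ρ : ℕ → ℝ) {ρ₀ θ : ℝ} (hρ₀ : 0 < ρ₀) (hρ : ∀ j < k, ρ₀ ≤ ρ j)
    (hgap : ∀ j < k, ρ k + ((k - j : ℕ) : ℝ) * θ ≤ ρ j)
    (hθ : (P.L : ℝ) ^ (P.d - 1) * Real.exp (-(min (δ / 32) (δC / 4) * θ)) ≤ 1 / 2)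
    (hCm : ∀ j < k, ∀ b₁ b₂ : PBond P j, |Cmat P j b₁ b₂| ≤ MC * Real.exp (-(δC * (supDist b₁.src b₂.src : ℝ))))
    (hCl : ∀ j < k, ∀ b₁ b₂ : PBond P j, |Cloc P j (ρ j / 4) b₁ b₂| ≤ MC * Real.exp (-(δC * (supDist b₁.src b₂.src : ℝ))))
    (hCd : ∀ j < k, ∀ b₁ b₂ : PBond P j, |Cloc P j (ρ j / 4) b₁ b₂ - Cmat P j b₁ b₂| ≤
      MC * Real.exp (-(δC / 4 * ρ j)) * Real.exp (-(δC * (supDist b₁.src b₂.src : ℝ))))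
    (b : PBond P 0) (p' : TPlaq P k) :
    |∑ j ∈ Finset.range k, tT hd ρ k j b p'| ≤
      (2 + (1 + 16 * C / ρ₀) * Real.exp (δ / 2)) *
        (2 * M ^ 2 * MC * ((P.d : ℝ) ^ 2 * (Real.exp (min (δ / 2) δC / 2 / 2) * ((2 * (1 + P.d / (min (δ / 2) δC / 2))) ^ P.d) ^ 2))) *
        Real.exp (min (δ / 2) δC / 2 / 2) * Real.exp (-(min (δ / 32) (δC / 4) * ρ k)) *
        Real.exp (-(min (δ / 2) δC / 2 * distEU P k b.src p'.src)) := by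
  set c₁ : ℝ := min (δ / 32) (δC / 4) with hc₁
  have hc₁0 : 0 ≤ c₁ := (lt_min (by positivity) (by positivity)).le
  set S₀ : ℝ := 2 + (1 + 16 * C / ρ₀) * Real.exp (δ / 2) with hS₀
  set Z : ℝ := 2 * M ^ 2 * MC * ((P.d : ℝ) ^ 2 * (Real.exp (min (δ / 2) δC / 2 / 2) * ((2 * (1 + P.d / (min (δ / 2) δC / 2))) ^ P.d) ^ 2))
    with hZ
  set E' : ℝ := Real.exp (min (δ / 2) δC / 2 / 2) * Real.exp (-(min (δ / 2) δC / 2 * distEU P k b.src p'.src)) with hE'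
  have hZ0 : 0 ≤ Z := by positivity
  have hE0 : 0 ≤ E' := by positivity
  have hC' : 0 ≤ 1 + 16 * C / ρ₀ := by positivity
  -- per scale
  have hj' : ∀ j < k, j ≤ P.m + P.K := fun j hj => by omega
  have hscale : ∀ j ∈ Finset.range k, |tT hd ρ k j b p'| ≤
      (S₀ * Z * E') * (((P.L : ℝ) ^ (P.d - 1)) ^ (k - j) * Real.exp (-(c₁ * ρ j))) := by
    intro j hjm
    have hjk := Finset.mem_range.1 hjm
    have h := abs_tT_le hd hk (hj' j hjk) hjk.le ha hδ hδC hM hMC (hH j (hj' j hjk) hjk) (hB j (hj' j hjk) hjk) hC0 hCζ ρ hρ₀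
      (hρ j hjk) (hCm j hjk) (hCl j hjk) (hCd j hjk) b p'
    refine h.trans ?_
    have hsm := smallness_le (δ := δ) (δC := δC) (C := C) (ρ₀ := ρ₀) hC' ((hρ₀.le).trans (hρ j hjk))
    rw [← hc₁, ← hS₀] at hsm
    rw [← hE']
    have hsplitZ : 2 * M ^ 2 * MC * ((P.L : ℝ) ^ (k - j)) ^ (P.d - 1) * ((P.d : ℝ) ^ 2 *
        (Real.exp (min (δ / 2) δC / 2 / 2) * ((2 * (1 + P.d / (min (δ / 2) δC / 2))) ^ P.d) ^ 2)) =
        Z * ((P.L : ℝ) ^ (P.d - 1)) ^ (k - j) := by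
      rw [hZ, pow_pow_comm']; ring
    rw [hsplitZ]
    have hY : 0 ≤ Z * ((P.L : ℝ) ^ (P.d - 1)) ^ (k - j) * E' := by positivity
    calc _ ≤ (S₀ * Real.exp (-(c₁ * ρ j))) * (Z * ((P.L : ℝ) ^ (P.d - 1)) ^ (k - j)) * E' :=
          mul_le_mul_of_nonneg_right (mul_le_mul_of_nonneg_right hsm (by positivity)) hE0
      _ = _ := by ring
  calc |∑ j ∈ Finset.range k, tT hd ρ k j b p'| ≤ ∑ j ∈ Finset.range k, |tT hd ρ k j b p'| := Finset.abs_sum_le_sum_abs _ _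
    _ ≤ ∑ j ∈ Finset.range k, (S₀ * Z * E') * (((P.L : ℝ) ^ (P.d - 1)) ^ (k - j) * Real.exp (-(c₁ * ρ j))) :=
        Finset.sum_le_sum hscale
    _ = (S₀ * Z * E') * ∑ j ∈ Finset.range k, ((P.L : ℝ) ^ (P.d - 1)) ^ (k - j) * Real.exp (-(c₁ * ρ j)) := by
        rw [Finset.mul_sum]
    _ ≤ (S₀ * Z * E') * Real.exp (-(c₁ * ρ k)) :=
        mul_le_mul_of_nonneg_left (sum_pow_smallness_le (pow_pos P.cast_L_pos _).le hc₁0 hθ hgap) (by positivity)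
    _ = _ := by rw [hE']; ring

/-! ## §6  The bound for `w′₁(b, b′)` -/

/-- one unit step of `T₁^{(k)}` moves the (7.2.2) distance by at most `1`: `dist_k(x, y + e_μ) ≤ dist_k(x, y) + 1` (block centres are `L^k`
apart). [cite: BalabanImbrieJaffe1985, (7.2.2) p.325] -/
theorem distEU_coarse_shift_le {k : ℕ} (hk : k ≤ P.m + P.K) (x : TSite P 0) (y : TSite P k) (μ : Fin P.d) :
    distEU P k x (y.shift μ) ≤ distEU P k x y + 1 := by
  have hLk : 0 < (P.L : ℝ) ^ k := cast_pow_L_pos' k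
  have h1 := supDist_triangle x (ctr k y) (ctr k (y.shift μ))
  have h2 : supDist (ctr k y) (ctr k (y.shift μ)) ≤ P.L ^ k := by
    rw [supDist_ctr_ctr hk]
    have h3 : supDist y (y.shift μ) ≤ 1 := by
      have h := supDist_runSite_le y μ 1
      have e : runSite y μ 1 = y.shift μ := by
        show Function.update y μ (y μ + ((1 : ℕ) : ZMod _)) = Function.update y μ (y μ + 1)
        rw [Nat.cast_one]
      rwa [e] at h
    calc P.L ^ k * supDist y (y.shift μ) ≤ P.L ^ k * 1 := Nat.mul_le_mul_left _ h3
      _ = P.L ^ k := mul_one _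
  rw [distEU, distEU, div_add_one hLk.ne', div_le_div_iff_of_pos_right hLk]
  have h4 : (supDist x (ctr k (y.shift μ)) : ℝ) ≤ (supDist x (ctr k y) : ℝ) + (supDist (ctr k y) (ctr k (y.shift μ)) : ℝ) := by
    exact_mod_cast h1
  have h5 : (supDist (ctr k y) (ctr k (y.shift μ)) : ℝ) ≤ (P.L : ℝ) ^ k := by exact_mod_cast h2
  linarith

/-- **THE BOUND FOR `w′₁(b, b′)` ON THE TORUS** (hypotheses of `abs_sum_tT_le`, a cube function `|χ| ≤ 1`): for every `η`-bond `b` and unit bond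
`b′`, `|w′₁(b, b′)| ≤ 4d·(2 + (1+16C_σ/ρ₀)e^{δ/2})·2M²M_C d²e^{a/2}K(a)²·e^{a/2}·e^{a}·e^{−c₁ρ_k}·e^{−a·dist_k(b₋, b′₋)}` — the reduction
`w1P_eq_sum`, the scale sum at each of the `≤ 4d` unit plaquettes through `b′` (`sum_abs_curl_boxSingle_mul_le`; one unit step from `p′₋` to
`b′₋` costs `e^{a}`). [cite: BalabanImbrieJaffe1988, (5.4.3) p.282] -/
theorem abs_w1P_le (hd : 2 ≤ P.d) {k : ℕ} (hk : k ≤ P.m + P.K) {a : ℝ} (ha : 0 < a)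
    {δ M δC MC : ℝ} (hδ : 0 < δ) (hδC : 0 < δC) (hM : 0 ≤ M) (hMC : 0 ≤ MC)
    (hH : ∀ (j : ℕ) (hj : j ≤ P.m + P.K), j < k → ∀ (μ ν : Fin P.d) (x : TSite P 0) (y : TSite P j),
      |(torusRep P j (deltaAData hj a)).H (x, μ) (y, ν)| ≤ M * Real.exp (-(δ * distEU P j x y)))
    (hB : ∀ (j : ℕ) (hj : j ≤ P.m + P.K), j < k → ∀ (μ ν : Fin P.d) (x : TSite P 0) (y : TSite P j),
      ‖fun lam : Fin P.d => (P.L : ℝ) ^ j *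
          ((torusRep P j (deltaAData hj a)).H (x.shift lam, μ) (y, ν) - (torusRep P j (deltaAData hj a)).H (x, μ) (y, ν))‖ ≤
        M * Real.exp (-(δ * distEU P j x y)))
    {C : ℝ} (hC0 : 0 ≤ C) (hCζ : ∀ (R₁ R₀ : ℝ), R₁ < R₀ → ∀ t s : ℝ,
      |cutoffProfile R₁ R₀ t - cutoffProfile R₁ R₀ s| ≤ C / (R₀ - R₁) * |t - s|)
    (ρ : ℕ → ℝ) {ρ₀ θ : ℝ} (hρ₀ : 0 < ρ₀) (hρ : ∀ j < k, ρ₀ ≤ ρ j)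
    (hgap : ∀ j < k, ρ k + ((k - j : ℕ) : ℝ) * θ ≤ ρ j)
    (hθ : (P.L : ℝ) ^ (P.d - 1) * Real.exp (-(min (δ / 32) (δC / 4) * θ)) ≤ 1 / 2)
    (hCm : ∀ j < k, ∀ b₁ b₂ : PBond P j, |Cmat P j b₁ b₂| ≤ MC * Real.exp (-(δC * (supDist b₁.src b₂.src : ℝ))))
    (hCl : ∀ j < k, ∀ b₁ b₂ : PBond P j, |Cloc P j (ρ j / 4) b₁ b₂| ≤ MC * Real.exp (-(δC * (supDist b₁.src b₂.src : ℝ))))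
    (hCd : ∀ j < k, ∀ b₁ b₂ : PBond P j, |Cloc P j (ρ j / 4) b₁ b₂ - Cmat P j b₁ b₂| ≤
      MC * Real.exp (-(δC / 4 * ρ j)) * Real.exp (-(δC * (supDist b₁.src b₂.src : ℝ))))
    (χ : PBond P k → ℝ) (hχ : ∀ b', |χ b'| ≤ 1) (b : PBond P 0) (b' : PBond P k) :
    |w1P hd ρ k χ b b'| ≤
      4 * P.d * ((2 + (1 + 16 * C / ρ₀) * Real.exp (δ / 2)) *
        (2 * M ^ 2 * MC * ((P.d : ℝ) ^ 2 * (Real.exp (min (δ / 2) δC / 2 / 2) * ((2 * (1 + P.d / (min (δ / 2) δC / 2))) ^ P.d) ^ 2))) *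
        Real.exp (min (δ / 2) δC / 2 / 2) * Real.exp (min (δ / 2) δC / 2)) * Real.exp (-(min (δ / 32) (δC / 4) * ρ k)) *
        Real.exp (-(min (δ / 2) δC / 2 * distEU P k b.src b'.src)) := by
  set aa : ℝ := min (δ / 2) δC / 2 with haa
  have haa0 : 0 < aa := half_pos (lt_min (half_pos hδ) hδC)
  set Y : ℝ := (2 + (1 + 16 * C / ρ₀) * Real.exp (δ / 2)) *
      (2 * M ^ 2 * MC * ((P.d : ℝ) ^ 2 * (Real.exp (aa / 2) * ((2 * (1 + P.d / aa)) ^ P.d) ^ 2))) *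
      Real.exp (aa / 2) * Real.exp (-(min (δ / 32) (δC / 4) * ρ k)) with hY
  have hY0 : 0 ≤ Y := by positivity
  clear_value Y
  -- the weight at a unit plaquette through `b′`
  have hsum : ∀ p' : TPlaq P k, |∑ j ∈ Finset.range k, tT hd ρ k j b p'| ≤ Y * Real.exp (-(aa * distEU P k b.src p'.src)) := by
    intro p'
    have h := abs_sum_tT_le hd hk ha hδ hδC hM hMC hH hB hC0 hCζ ρ hρ₀ hρ hgap hθ hCm hCl hCd b p'
    rw [← haa] at h
    refine h.trans (le_of_eq ?_)
    rw [hY]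
  have hnear : ∀ p' : TPlaq P k, distEU P k b.src b'.src ≤ distEU P k b.src p'.src + 1 →
      |∑ j ∈ Finset.range k, tT hd ρ k j b p'| ≤ Y * Real.exp aa * Real.exp (-(aa * distEU P k b.src b'.src)) := by
    intro p' hp'
    refine (hsum p').trans ?_
    have hexp : Real.exp (-(aa * distEU P k b.src p'.src)) ≤ Real.exp aa * Real.exp (-(aa * distEU P k b.src b'.src)) := by
      rw [← Real.exp_add]; exact Real.exp_le_exp.2 (by nlinarith)
    calc Y * Real.exp (-(aa * distEU P k b.src p'.src)) ≤ Y * (Real.exp aa * Real.exp (-(aa * distEU P k b.src b'.src))) :=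
        mul_le_mul_of_nonneg_left hexp hY0
      _ = _ := (mul_assoc _ _ _).symm
  have hW1 : ∀ p' : TPlaq P k, (⟨p'.src, p'.μ⟩ : PBond P k) = b' →
      |∑ j ∈ Finset.range k, tT hd ρ k j b p'| ≤ Y * Real.exp aa * Real.exp (-(aa * distEU P k b.src b'.src)) := by
    intro p' h; refine hnear p' ?_; rw [← h]; linarith
  have hW2 : ∀ p' : TPlaq P k, (⟨p'.src.shift p'.μ, p'.ν⟩ : PBond P k) = b' →
      |∑ j ∈ Finset.range k, tT hd ρ k j b p'| ≤ Y * Real.exp aa * Real.exp (-(aa * distEU P k b.src b'.src)) := by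
    intro p' h; refine hnear p' ?_; rw [← h]; exact distEU_coarse_shift_le hk b.src p'.src p'.μ
  have hW3 : ∀ p' : TPlaq P k, (⟨p'.src.shift p'.ν, p'.μ⟩ : PBond P k) = b' →
      |∑ j ∈ Finset.range k, tT hd ρ k j b p'| ≤ Y * Real.exp aa * Real.exp (-(aa * distEU P k b.src b'.src)) := by
    intro p' h; refine hnear p' ?_; rw [← h]; exact distEU_coarse_shift_le hk b.src p'.src p'.ν
  have hW4 : ∀ p' : TPlaq P k, (⟨p'.src, p'.ν⟩ : PBond P k) = b' →
      |∑ j ∈ Finset.range k, tT hd ρ k j b p'| ≤ Y * Real.exp aa * Real.exp (-(aa * distEU P k b.src b'.src)) := by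
    intro p' h; refine hnear p' ?_; rw [← h]; linarith
  have hmain := sum_abs_curl_boxSingle_mul_le χ b' (w := fun p' => |∑ j ∈ Finset.range k, tT hd ρ k j b p'|)
    (fun p' => abs_nonneg _) (by positivity) hW1 hW2 hW3 hW4
  refine (abs_w1P_le_sum hd ρ χ b b').trans (hmain.trans ?_)
  have hχ1 := hχ b'
  have hpos : 0 ≤ 4 * (P.d : ℝ) * (Y * Real.exp aa * Real.exp (-(aa * distEU P k b.src b'.src))) := by positivity
  calc 4 * P.d * |χ b'| * (Y * Real.exp aa * Real.exp (-(aa * distEU P k b.src b'.src)))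
      ≤ 4 * P.d * 1 * (Y * Real.exp aa * Real.exp (-(aa * distEU P k b.src b'.src))) := by nlinarith
    _ = _ := by rw [hY]; ring


/-! ## §7  r16's `Ineq547` for `w′₁` on every torus — no hypothesis -/

/-- absorbing a prefactor into the smallness: `Ae^{−c₁ρ}e^{−aD} ≤ e^{−c′ρ}e^{−c′D}`, `c′ = min(c₁/2, a)`, once `ρ ≥ 2log(max(A,1))/c₁`
(`ρ, D ≥ 0`). [folklore] -/
private theorem absorb {A c₁ a ρ D : ℝ} (hc₁ : 0 < c₁) (hD : 0 ≤ D) (hρ : 2 * Real.log (max A 1) / c₁ ≤ ρ) (hρ0 : 0 ≤ ρ) :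
    A * Real.exp (-(c₁ * ρ)) * Real.exp (-(a * D)) ≤ Real.exp (-(min (c₁ / 2) a * ρ)) * Real.exp (-(min (c₁ / 2) a * D)) := by
  have hmax : 0 < max A 1 := lt_of_lt_of_le one_pos (le_max_right _ _)
  have hlog : Real.log (max A 1) ≤ c₁ / 2 * ρ := by
    rw [div_le_iff₀ hc₁] at hρ; linarith
  have h1 : A ≤ Real.exp (c₁ / 2 * ρ) :=
    (le_max_left A 1).trans (by rw [← Real.exp_log hmax]; exact Real.exp_le_exp.2 hlog)
  have h2 : A * Real.exp (-(c₁ * ρ)) ≤ Real.exp (-(min (c₁ / 2) a * ρ)) := by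
    calc A * Real.exp (-(c₁ * ρ)) ≤ Real.exp (c₁ / 2 * ρ) * Real.exp (-(c₁ * ρ)) :=
          mul_le_mul_of_nonneg_right h1 (Real.exp_pos _).le
      _ = Real.exp (-(c₁ / 2 * ρ)) := by rw [← Real.exp_add]; ring_nf
      _ ≤ _ := Real.exp_le_exp.2 (by nlinarith [min_le_left (c₁ / 2) a])
  have h3 : Real.exp (-(a * D)) ≤ Real.exp (-(min (c₁ / 2) a * D)) := Real.exp_le_exp.2 (by nlinarith [min_le_right (c₁ / 2) a])
  calc A * Real.exp (-(c₁ * ρ)) * Real.exp (-(a * D)) ≤ Real.exp (-(min (c₁ / 2) a * ρ)) * Real.exp (-(a * D)) :=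
        mul_le_mul_of_nonneg_right h2 (Real.exp_pos _).le
    _ ≤ _ := mul_le_mul_of_nonneg_left h3 (Real.exp_pos _).le

/-- the scale-gap threshold: with `θ₀ = log(2Λ)/c₁`, `Λe^{−c₁θ₀} = ½` (`Λ, c₁ > 0`). [folklore] -/
private theorem gap_threshold {Λ c₁ : ℝ} (hΛ : 0 < Λ) (hc₁ : 0 < c₁) : Λ * Real.exp (-(c₁ * (Real.log (2 * Λ) / c₁))) ≤ 1 / 2 := by
  have h2 : 0 < 2 * Λ := by positivity
  rw [mul_div_cancel₀ _ hc₁.ne', Real.exp_neg, Real.exp_log h2]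
  rw [show Λ * (2 * Λ)⁻¹ = 1 / 2 by field_simp]

/-- **(5.4.7)-SHAPE FOR `w′₁` ON EVERY TORUS OF THE SERIES, FOR THE KERNELS OF RECORD — NO HYPOTHESIS** (`d ≥ 2`; per-tower [6I] Prop. 1.2 is
p16's theorem `prop12Printed_levStd_deltaA`, p09's `cloc_estimates`, p13/p08's profile slope `exists_cutoffProfile_lipschitz`; the objects do not
depend on the mass parameter, taken `a = 1`): there are `c, θ₀, ρ₁ > 0` such that for every `k ≤ m + K`, every radius schedule `ρ` with
`ρ_k ≥ ρ₁` and THE SCALE GAP `ρ_j ≥ ρ_k + (k−j)θ₀` (`j < k`; for the printed `ρ_j = r(e_j)` this is p08 g4's `rLen_scale_gap`, `θ_k → ∞` as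
`e_k → 0`), and every cube function `|χ| ≤ 1`, r16's typed shape holds:
`Ineq547 (T_η-bonds) (T₁^{(k)}-bonds) w′₁ dist_k c ρ_k`, i.e. **`|w′₁(b, b′)| ≤ e^{−cρ_k}e^{−c·dist_k(b₋, b′₋)}` for all `b, b′`** — print's
*"≦ e^{−cr(e_k)}e^{−c dist(p,b′)}, and similarly for w′₁"*. [cite: BalabanImbrieJaffe1988, (5.4.7) p.282] -/
theorem ineq547_w1P_torus (hd : 2 ≤ P.d) :
    ∃ c θ₀ ρ₁ : ℝ, 0 < c ∧ 0 < θ₀ ∧ 0 < ρ₁ ∧ ∀ (k : ℕ) (_ : k ≤ P.m + P.K) (ρ : ℕ → ℝ),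
      ρ₁ ≤ ρ k → (∀ j < k, ρ k + ((k - j : ℕ) : ℝ) * θ₀ ≤ ρ j) →
      ∀ (χ : PBond P k → ℝ), (∀ b', |χ b'| ≤ 1) →
        Ineq547 (PBond P 0) (PBond P k) (w1P hd ρ k χ) (fun b b' => distEU P k b.src b'.src) c (ρ k) := by
  classical
  have h722 := ineq722_deltaA_of_prop12Printed (levStd P) levStd_le one_pos (fun _ => PUnit) (fun _ _ _ => 0) (fun _ _ _ _ _ => 0)
    (fun _ _ _ => 0) (prop12Printed_levStd_deltaA P 1)
  obtain ⟨δ, M, hδ, hM, hBall⟩ := exists_bound_of_ineq722 levStd_le h722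
  obtain ⟨MC, δ₀, hMC, hδ₀, HC⟩ := cloc_estimates P.d P.L hd
  obtain ⟨C, hC0, hCζ⟩ := exists_cutoffProfile_lipschitz
  have hcov : ∀ j ≤ P.m + P.K, ∃ i, levStd P i = j := fun j hj => ⟨j, min_eq_left hj⟩
  have hδC : 0 < δ₀ / 2 := half_pos hδ₀
  set MC' : ℝ := MC * (Real.exp (4 * δ₀ * P.L) * (1 + P.L) ^ 2) with hMC'
  have hMC'0 : 0 ≤ MC' := by positivity
  set c₁ : ℝ := min (δ / 32) (δ₀ / 2 / 4) with hc₁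
  have hc₁0 : 0 < c₁ := lt_min (by positivity) (by positivity)
  set aa : ℝ := min (δ / 2) (δ₀ / 2) / 2 with haa
  have haa0 : 0 < aa := half_pos (lt_min (half_pos hδ) hδC)
  set Λ : ℝ := (P.L : ℝ) ^ (P.d - 1) with hΛ
  have hΛ0 : 0 < Λ := pow_pos P.cast_L_pos _
  set θ₀ : ℝ := Real.log (2 * Λ) / c₁ with hθ₀
  have hθ₀0 : 0 < θ₀ := by
    refine div_pos (Real.log_pos ?_) hc₁0
    have : (1 : ℝ) ≤ Λ := one_le_pow₀ (by exact_mod_cast P.L_pos)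
    linarith
  set A : ℝ := 4 * P.d * ((2 + (1 + 16 * C / 1) * Real.exp (δ / 2)) *
      (2 * M ^ 2 * MC' * ((P.d : ℝ) ^ 2 * (Real.exp (aa / 2) * ((2 * (1 + P.d / aa)) ^ P.d) ^ 2))) *
      Real.exp (aa / 2) * Real.exp aa) with hA
  set ρ₁ : ℝ := max 1 (2 * Real.log (max A 1) / c₁) with hρ₁
  have hρ₁1 : 1 ≤ ρ₁ := le_max_left _ _
  refine ⟨min (c₁ / 2) aa, θ₀, ρ₁, lt_min (half_pos hc₁0) haa0, hθ₀0, lt_of_lt_of_le one_pos hρ₁1,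
    fun k hk ρ hρk hgap χ hχ => ?_⟩
  -- the kernel data at every scale `j < k`
  have hH : ∀ (j : ℕ) (hj : j ≤ P.m + P.K), j < k → ∀ (μ ν : Fin P.d) (x : TSite P 0) (y : TSite P j),
      |(torusRep P j (deltaAData hj 1)).H (x, μ) (y, ν)| ≤ M * Real.exp (-(δ * distEU P j x y)) := by
    intro j hj _ μ ν x y
    obtain ⟨i, hi⟩ := hcov j hj
    subst hi
    exact (le_add_of_nonneg_right torusKernelData_gradH_nonneg).trans (hBall i μ ν x y)
  have hB : ∀ (j : ℕ) (hj : j ≤ P.m + P.K), j < k → ∀ (μ ν : Fin P.d) (x : TSite P 0) (y : TSite P j),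
      ‖fun lam : Fin P.d => (P.L : ℝ) ^ j *
          ((torusRep P j (deltaAData hj 1)).H (x.shift lam, μ) (y, ν) - (torusRep P j (deltaAData hj 1)).H (x, μ) (y, ν))‖ ≤
        M * Real.exp (-(δ * distEU P j x y)) := by
    intro j hj _ μ ν x y
    obtain ⟨i, hi⟩ := hcov j hj
    subst hi
    have h := hBall i μ ν x y
    rw [torusKernelData_gradH] at h
    exact (le_add_of_nonneg_left (abs_nonneg _)).trans h
  have hC : ∀ j < k, (∀ b₁ b₂ : PBond P j, |Cmat P j b₁ b₂| ≤ MC' * Real.exp (-(δ₀ / 2 * (supDist b₁.src b₂.src : ℝ)))) ∧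
      (∀ b₁ b₂ : PBond P j, |Cloc P j (ρ j / 4) b₁ b₂| ≤ MC' * Real.exp (-(δ₀ / 2 * (supDist b₁.src b₂.src : ℝ)))) ∧
      (∀ b₁ b₂ : PBond P j, |Cloc P j (ρ j / 4) b₁ b₂ - Cmat P j b₁ b₂| ≤
        MC' * Real.exp (-(δ₀ / 2 / 4 * ρ j)) * Real.exp (-(δ₀ / 2 * (supDist b₁.src b₂.src : ℝ)))) :=
    fun j hjk => cSide_of_cloc_estimates hMC hδ₀ (fun R b b' => HC P rfl rfl j inferInstance (by omega) R b b') (ρ j)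
  -- the schedule
  have hρk0 : 0 ≤ ρ k := by linarith
  have hρ : ∀ j < k, (1 : ℝ) ≤ ρ j := by
    intro j hj
    have h := hgap j hj
    have : 0 ≤ ((k - j : ℕ) : ℝ) * θ₀ := mul_nonneg (Nat.cast_nonneg _) hθ₀0.le
    linarith
  have hθ : Λ * Real.exp (-(c₁ * θ₀)) ≤ 1 / 2 := gap_threshold hΛ0 hc₁0
  intro b b'
  have hw := abs_w1P_le hd hk one_pos hδ hδC hM hMC'0 hH hB hC0 hCζ ρ one_pos hρ hgap hθ
    (fun j hjk => (hC j hjk).1) (fun j hjk => (hC j hjk).2.1) (fun j hjk => (hC j hjk).2.2) χ hχ b b'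
  have hD : 0 ≤ distEU P k b.src b'.src := div_nonneg (Nat.cast_nonneg _) (cast_pow_L_pos' k).le
  have hρA : 2 * Real.log (max A 1) / c₁ ≤ ρ k := (le_max_right _ _).trans hρk
  exact hw.trans (absorb hc₁0 hD hρA hρk0)


/-! ## §8  Over all tori: one set of constants, hypothesis-free -/

/-- **(5.4.7)-SHAPE FOR `w′₁` OVER ALL TORI FROM [6I] PROP. 1.2 BY ITS TREE NAME** (`2 ≤ d`, `L` odd `> 1`): ONE `(c, θ₀, ρ₁)` for EVERY torus
(`P.d = d`, `P.L = L`), every `k ≤ m + K`, every schedule with `ρ_k ≥ ρ₁` and scale gap `θ₀`, every cube function `|χ| ≤ 1` (p08's all-tori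
sup + gradient lemma `exists_HB_allTori_of_prop12Printed`, p09's all-tori `cloc_estimates`). [cite: BalabanImbrieJaffe1988, (5.4.7) p.282] -/
theorem ineq547_w1P_allTori_of_prop12Printed {d L : ℕ} (hd : 2 ≤ d) (hL : Odd L ∧ 1 < L) {a : ℝ} (ha : 0 < a)
    (h12 : B5.Prop12Printed (fun i : {x : Params × ℕ // x.1.d = d ∧ x.1.L = L ∧ 1 ≤ x.2 ∧ x.2 ≤ x.1.m + x.1.K} =>
      settingOf (torusRep i.1.1 i.1.2 (deltaAData i.2.2.2.2 a)) i.1.2)) :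
    ∃ c θ₀ ρ₁ : ℝ, 0 < c ∧ 0 < θ₀ ∧ 0 < ρ₁ ∧ ∀ (P : Params) (hPd : P.d = d) (_ : P.L = L) (k : ℕ) (_ : k ≤ P.m + P.K) (ρ : ℕ → ℝ),
      ρ₁ ≤ ρ k → (∀ j < k, ρ k + ((k - j : ℕ) : ℝ) * θ₀ ≤ ρ j) →
      ∀ (χ : PBond P k → ℝ), (∀ b', |χ b'| ≤ 1) →
        Ineq547 (PBond P 0) (PBond P k) (w1P (hPd ▸ hd) ρ k χ) (fun b b' => distEU P k b.src b'.src) c (ρ k) := by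
  classical
  obtain ⟨δ, M, hδ, hM1, hHB⟩ := exists_HB_allTori_of_prop12Printed (le_trans one_le_two hd) hL ha h12
  obtain ⟨MC, δ₀, hMC, hδ₀, HC⟩ := cloc_estimates d L hd
  obtain ⟨C, hC0, hCζ⟩ := exists_cutoffProfile_lipschitz
  have hδC : 0 < δ₀ / 2 := half_pos hδ₀
  have hM : 0 ≤ M := zero_le_one.trans hM1
  have hL0 : (0 : ℝ) < L := by have := hL.2; exact_mod_cast (by omega : 0 < L)
  set MC' : ℝ := MC * (Real.exp (4 * δ₀ * L) * (1 + L) ^ 2) with hMC'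
  have hMC'0 : 0 ≤ MC' := by positivity
  set c₁ : ℝ := min (δ / 32) (δ₀ / 2 / 4) with hc₁
  have hc₁0 : 0 < c₁ := lt_min (by positivity) (by positivity)
  set aa : ℝ := min (δ / 2) (δ₀ / 2) / 2 with haa
  have haa0 : 0 < aa := half_pos (lt_min (half_pos hδ) hδC)
  set Λ : ℝ := (L : ℝ) ^ (d - 1) with hΛ
  have hΛ0 : 0 < Λ := pow_pos hL0 _
  set θ₀ : ℝ := Real.log (2 * Λ) / c₁ with hθ₀
  have hθ₀0 : 0 < θ₀ := by
    refine div_pos (Real.log_pos ?_) hc₁0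
    have : (1 : ℝ) ≤ Λ := one_le_pow₀ (by have := hL.2; exact_mod_cast (by omega : 1 ≤ L))
    linarith
  set A : ℝ := 4 * d * ((2 + (1 + 16 * C / 1) * Real.exp (δ / 2)) *
      (2 * M ^ 2 * MC' * ((d : ℝ) ^ 2 * (Real.exp (aa / 2) * ((2 * (1 + d / aa)) ^ d) ^ 2))) *
      Real.exp (aa / 2) * Real.exp aa) with hA
  set ρ₁ : ℝ := max 1 (2 * Real.log (max A 1) / c₁) with hρ₁
  have hρ₁1 : 1 ≤ ρ₁ := le_max_left _ _
  refine ⟨min (c₁ / 2) aa, θ₀, ρ₁, lt_min (half_pos hc₁0) haa0, hθ₀0, lt_of_lt_of_le one_pos hρ₁1,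
    fun P hPd hPL k hk ρ hρk hgap χ hχ => ?_⟩
  subst hPd; subst hPL
  have hH : ∀ (j : ℕ) (hj : j ≤ P.m + P.K), j < k → ∀ (μ ν : Fin P.d) (x : TSite P 0) (y : TSite P j),
      |(torusRep P j (deltaAData hj a)).H (x, μ) (y, ν)| ≤ M * Real.exp (-(δ * distEU P j x y)) :=
    fun j hj _ μ ν x y => (hHB P rfl rfl j hj μ ν x y).1
  have hB : ∀ (j : ℕ) (hj : j ≤ P.m + P.K), j < k → ∀ (μ ν : Fin P.d) (x : TSite P 0) (y : TSite P j),
      ‖fun lam : Fin P.d => (P.L : ℝ) ^ j *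
          ((torusRep P j (deltaAData hj a)).H (x.shift lam, μ) (y, ν) - (torusRep P j (deltaAData hj a)).H (x, μ) (y, ν))‖ ≤
        M * Real.exp (-(δ * distEU P j x y)) :=
    fun j hj _ μ ν x y => (hHB P rfl rfl j hj μ ν x y).2
  have hC : ∀ j < k, (∀ b₁ b₂ : PBond P j, |Cmat P j b₁ b₂| ≤ MC' * Real.exp (-(δ₀ / 2 * (supDist b₁.src b₂.src : ℝ)))) ∧
      (∀ b₁ b₂ : PBond P j, |Cloc P j (ρ j / 4) b₁ b₂| ≤ MC' * Real.exp (-(δ₀ / 2 * (supDist b₁.src b₂.src : ℝ)))) ∧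
      (∀ b₁ b₂ : PBond P j, |Cloc P j (ρ j / 4) b₁ b₂ - Cmat P j b₁ b₂| ≤
        MC' * Real.exp (-(δ₀ / 2 / 4 * ρ j)) * Real.exp (-(δ₀ / 2 * (supDist b₁.src b₂.src : ℝ)))) :=
    fun j hjk => cSide_of_cloc_estimates hMC hδ₀ (fun R b b' => HC P rfl rfl j inferInstance (by omega) R b b') (ρ j)
  have hρk0 : 0 ≤ ρ k := by linarith
  have hρ : ∀ j < k, (1 : ℝ) ≤ ρ j := by
    intro j hj
    have h := hgap j hj
    have : 0 ≤ ((k - j : ℕ) : ℝ) * θ₀ := mul_nonneg (Nat.cast_nonneg _) hθ₀0.le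
    linarith
  have hθ : Λ * Real.exp (-(c₁ * θ₀)) ≤ 1 / 2 := gap_threshold hΛ0 hc₁0
  intro b b'
  have hw := abs_w1P_le hd hk ha hδ hδC hM hMC'0 hH hB hC0 hCζ ρ one_pos hρ hgap hθ
    (fun j hjk => (hC j hjk).1) (fun j hjk => (hC j hjk).2.1) (fun j hjk => (hC j hjk).2.2) χ hχ b b'
  have hD : 0 ≤ distEU P k b.src b'.src := div_nonneg (Nat.cast_nonneg _) (cast_pow_L_pos' k).le
  have hρA : 2 * Real.log (max A 1) / c₁ ≤ ρ k := (le_max_right _ _).trans hρk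
  exact hw.trans (absorb hc₁0 hD hρA hρk0)

/-- **(5.4.7)-SHAPE FOR `w′₁` OVER ALL TORI, HYPOTHESIS-FREE** (`2 ≤ d`, `L` odd `> 1`): ONE `(c, θ₀, ρ₁)` for every torus, every `k ≤ m + K`,
every admissible schedule and cube function — §8's theorem with [6I] Prop. 1.2 supplied by p19's `prop12Printed_allTori` (at `a = 1`).
[cite: BalabanImbrieJaffe1988, (5.4.7) p.282] -/
theorem ineq547_w1P_allTori {d L : ℕ} (hd : 2 ≤ d) (hL : Odd L ∧ 1 < L) :
    ∃ c θ₀ ρ₁ : ℝ, 0 < c ∧ 0 < θ₀ ∧ 0 < ρ₁ ∧ ∀ (P : Params) (hPd : P.d = d) (_ : P.L = L) (k : ℕ) (_ : k ≤ P.m + P.K) (ρ : ℕ → ℝ),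
      ρ₁ ≤ ρ k → (∀ j < k, ρ k + ((k - j : ℕ) : ℝ) * θ₀ ≤ ρ j) →
      ∀ (χ : PBond P k → ℝ), (∀ b', |χ b'| ≤ 1) →
        Ineq547 (PBond P 0) (PBond P k) (w1P (hPd ▸ hd) ρ k χ) (fun b b' => distEU P k b.src b'.src) c (ρ k) :=
  ineq547_w1P_allTori_of_prop12Printed hd hL one_pos (prop12Printed_allTori d L one_pos)

end

end Literature.MathematicalPhysics.QuantumFieldTheory.BalabanImbrieJaffe1984to88.BIJ88W1Prime543Bound
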